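import Literature.Geometry.Riemannian.ShrinkerEntropyAllScalesMoments
import Mathlib.Analysis.Calculus.MeanValue
import Mathlib.Analysis.SpecialFunctions.Log.Deriv
import HarnessLib

/-!
# Li–Wang 2020, towards Thm. 1.1 (all-scales LSI of a shrinker): Perelman's entropy monotonicity
# in the static frame, along the weighted heat semigroup

Fourth proof file towards `LiWang2020_shrinkerLSI_allScales_holds` (`ShrinkerEntropyAllScales.lean`;
Y. Li, B. Wang, *Heat kernel on Ricci shrinkers*, Calc. Var. PDE 59 (2020) = arXiv:1901.05691,
Thm. 1.1 / Prop. 5.9). The printed proof runs Perelman's monotonicity of the `𝒲`-functional along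
the conjugate heat flow of the Ricci flow `g(t) = (1 − t)(ψᵗ)^*g` induced by the shrinker
(Thm. 4.3, Thm. 4.5, Prop. 5.7, Lemma 5.10 with (PK08_6)–(PK08_7): `θ(t) = (η₀ − t)/(1 − t)`).
Pulling back by the self-similar diffeomorphisms `ψᵗ` and reparametrising `s = −log(1 − t)`, the
conjugate heat flow becomes the STATIC weighted heat flow `∂ₛu = Lu = Δu − g⁻¹(df, du)` on
`(M, g, e^{-f}dV)`, the scale becomes `τ(s) = 1 + (τ₀ − 1)e^{-s}` (`τ' = 1 − τ`), and Perelman's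
formula reads, with `H = ∫ u log u`, `I = ∫ |∇u|²/u`, `F = ∫ f u` (all against `e^{-V}`,
`V = f + c`) and `Φ = τI − H + (1 − τ)(F − n) − (n/2) log τ`,
`Φ' = −2τ ∫ |Hess log u + Ric − g/2τ|² u ≤ 0`, using `dH/ds = −I`, `dF/ds = n/2 − F`
(`Lf = n/2 − f`) and the weighted Bochner formula with `Ric_f = g/2`. This file proves the
resulting inequality `Φ(0) ≥ lim Φ = 0` rigorously on the complete non-compact shrinker, GIVEN the
semigroup `P t` of `weightedHeatSemigroup_strongGradientBound_complete` (properties (i)–(iv),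
`K = 1/2`), for initial densities `e^φ` with `φ` smooth and constant outside a compact set:

* `shrinker_asei_eventuallyConst_of_flow` —
  `∫ φ e^φ e^{-V} ≤ τ₀ ∫ |∇φ|² e^φ e^{-V} + (1 − τ₀)(∫ f e^φ e^{-V} − n) − (n/2) log τ₀` (`τ₀ > 0`)
  GIVEN only the solution `u` of the weighted heat equation started at `e^φ` with its a-priori
  properties (jointly smooth on `M × [0, ∞)`, values in `[a, b]` with `a > 0`, `|Lu|` bounded,
  gradient decay `|∇u(t)|² ≤ e^{-t}C`, unit mass) — the analytic input in its weakest form, to be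
  fed by ANY construction of the weighted heat flow on the complete shrinker;
* `shrinker_asei_eventuallyConst_of_semigroup` — the same for `φ` constant outside a compact set,
  from the semigroup `P t` (the a-priori properties of `u(t) = P_t e^φ` follow from the Markov
  property, the invariance of `e^{-V}` and the strong gradient bound): Li–Wang's Thm. 1.1 at scale
  `τ₀` for such densities, in the `e^{-V}`-normalisation of the tree's Bakry–Émery pipeline
  (`BakryEmeryLogSobolevSemigroup.lean` is the case "`τ₀ = 1`" without the dimensional term).

The time derivative of the Fisher information is taken INSIDE Li–Wang's cut-offs `χ_r = η(f/r)`
(`ShrinkerEntropyAllScalesFlow.lean`: Leibniz rule on a compact support, the dimensional Bochner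
inequality for the Fisher density `fisherDensity_pointwise_le_dim`, the symmetry `∫ χ LQ = ∫ Q Lχ`
and `|Lχ_r| ≤ C 𝟙_{f ≥ r}`), which makes all error terms `O(1/r)` by `∫ f e^{-f}, ∫ f² e^{-f} < ∞`;
the `f`-moment and the identity `∫ u Δ log u = −I − n/2 + F` come from
`ShrinkerEntropyAllScalesMoments.lean`; `dH/dt = −I`, `H → 0` from
`WeightedHeatFlowComplete{Entropy,Decay}.lean`. Also: the one-variable calculus of the scale
function and of the comparison/limit argument (namespace `LiWang2020`), a Cauchy–Schwarz inequality
against a sub-probability weight, and the chain rule for `u Δ(−log u)`.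

Theorems only; no definitions, no named facts (D-0026).

## References

* [LiWang2020] Y. Li, B. Wang, Calc. Var. PDE 59 (2020) no. 194 (arXiv:1901.05691): Thm. 1.1
  (p. 3), Thm. 4.3 and Thm. 4.5 (pp. 14–16), §5: Thm. 5.4, Lemmas 5.5–5.6, Prop. 5.7, Prop. 5.9,
  Lemma 5.10 and Lemma 5.11 (pp. 18–21). READ (held text paper:arxiv-1901.05691).
* [Perelman2002] G. Perelman, *The entropy formula for the Ricci flow and its geometric
  applications*, arXiv:math/0211159, §3 (the `𝒲`-functional and its monotonicity).
* [BakryGentilLedoux2014] D. Bakry, I. Gentil, M. Ledoux, *Analysis and Geometry of Markov Diffusion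
  Operators*, Springer 2014, Prop. 5.7.1 (p. 268) and §3.2.
* [CarrilloNi2009] J. A. Carrillo, L. Ni, Comm. Anal. Geom. 17 (2009), §§3–4.
-/

noncomputable section

open Bundle Set Function Filter Module Manifold MeasureTheory
open scoped Manifold ContDiff Topology ENNReal NNReal

namespace Literature.Geometry.Riemannian

open Lorentzian Lorentzian.PseudoRiemannianMetric CarrilloNi2009_shrinkerLSI

universe uM

/-! ### Cauchy–Schwarz against a sub-probability weight -/

/-- `(∫ A m)² ≤ ∫ A² m` for a weight `m ≥ 0` of mass `≤ 1` (expand `0 ≤ ∫ (A − ∫ A m)² m`).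
[folklore] -/
theorem sq_integral_mul_le_of_mass_le_one {α : Type*} [MeasurableSpace α] {μ : Measure α}
    {A m : α → ℝ} (hm0 : ∀ x, 0 ≤ m x) (hm1 : ∫ x, m x ∂μ ≤ 1) (im : Integrable m μ)
    (iA : Integrable (fun x ↦ A x * m x) μ) (iA2 : Integrable (fun x ↦ A x ^ 2 * m x) μ) :
    (∫ x, A x * m x ∂μ) ^ 2 ≤ ∫ x, A x ^ 2 * m x ∂μ := by
  set Y : ℝ := ∫ x, A x * m x ∂μ with hY
  have h0 : 0 ≤ ∫ x, (A x - Y) ^ 2 * m x ∂μ :=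
    integral_nonneg fun x ↦ mul_nonneg (sq_nonneg _) (hm0 x)
  have hpt : ∀ x, (A x - Y) ^ 2 * m x = (A x ^ 2 * m x - 2 * Y * (A x * m x)) + Y ^ 2 * m x :=
    fun x ↦ by ring
  have i1 : Integrable (fun x ↦ 2 * Y * (A x * m x)) μ := iA.const_mul _
  have i2 : Integrable (fun x ↦ Y ^ 2 * m x) μ := im.const_mul _
  have hexp : ∫ x, (A x - Y) ^ 2 * m x ∂μ =
      (∫ x, A x ^ 2 * m x ∂μ) - 2 * Y * Y + Y ^ 2 * ∫ x, m x ∂μ := by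
    have i3 : Integrable (fun x ↦ A x ^ 2 * m x - 2 * Y * (A x * m x)) μ := iA2.sub i1
    simp_rw [hpt]
    rw [integral_add i3 i2, integral_sub iA2 i1, integral_const_mul, integral_const_mul]
  have hmnn : 0 ≤ ∫ x, m x ∂μ := integral_nonneg hm0
  rw [hexp] at h0
  nlinarith [mul_le_mul_of_nonneg_left hm1 (sq_nonneg Y)]

/-! ### The unweighted Laplacian of `−log u` -/

section NegLog

variable {n : ℕ} {M : Type uM} [TopologicalSpace M] [T2Space M] [SecondCountableTopology M]
  [ChartedSpace (EuclideanSpace ℝ (Fin n)) M] [IsManifold (𝓡 n) ∞ M] [ConnectedSpace M]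
  [T3Space M] [MeasurableSpace M] [BorelSpace M]
  {g : PseudoRiemannianMetric (𝓡 n) ∞ (EuclideanSpace ℝ (Fin n)) (TangentSpace (𝓡 n) : M → Type _)}
  [g.HasLeviCivita] {f : M → ℝ}

omit [T2Space M] [SecondCountableTopology M] [ConnectedSpace M] [T3Space M] [MeasurableSpace M]
  [BorelSpace M] in
/-- `Δ_g(−log u) = −Δ_g(log u)`. [folklore] -/
theorem dalembertian_negLog_eq {u : M → ℝ} (hu : ContMDiff (𝓡 n) 𝓘(ℝ, ℝ) ∞ u)
    (hpos : ∀ x, 0 < u x) (x : M) :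
    g.dalembertian (fun y ↦ -Real.log (u y)) x = -g.dalembertian (fun y ↦ Real.log (u y)) x := by
  have hlog : ContMDiff (𝓡 n) 𝓘(ℝ, ℝ) ∞ (fun y ↦ Real.log (u y)) := fun y ↦
    (Real.contDiffAt_log.2 (hpos y).ne').comp_contMDiffWithinAt (hu y)
  have h2 : ContMDiffAt (𝓡 n) 𝓘(ℝ, ℝ) 2 (fun y ↦ Real.log (u y)) x :=
    (hlog.of_le (WithTop.coe_le_coe.mpr le_top)).contMDiffAt
  have h := dalembertian_const_mul_of_contMDiffAt (g := g) h2 (-1)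
  rw [show (fun y ↦ -Real.log (u y)) = fun y ↦ (-1) * Real.log (u y) from funext fun y ↦ by ring, h]
  ring

omit [T2Space M] [SecondCountableTopology M] [ConnectedSpace M] [T3Space M] [MeasurableSpace M]
  [BorelSpace M] in
/-- `u Δ_g(−log u) = |∇u|²/u − Δ_g u` (chain rule with `ζ = −log`). [cite: CarrilloNi2009, §3 (3.1)] -/
theorem dalembertian_negLog_mul {u : M → ℝ} (hu : ContMDiff (𝓡 n) 𝓘(ℝ, ℝ) ∞ u)
    (hpos : ∀ x, 0 < u x) (x : M) :
    g.dalembertian (fun y ↦ -Real.log (u y)) x * u x = g.gradSq u x / u x - g.dalembertian u x := by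
  have hne : u x ≠ 0 := (hpos x).ne'
  have hux2 : ContMDiffAt (𝓡 n) 𝓘(ℝ, ℝ) 2 u x := (hu.of_le (WithTop.coe_le_coe.mpr le_top)).contMDiffAt
  have hζ : ContDiffAt ℝ 2 (fun s : ℝ ↦ -Real.log s) (u x) := (Real.contDiffAt_log.2 hne).neg
  have hζ' : ∀ {s : ℝ}, s ≠ 0 → HasDerivAt (fun r : ℝ ↦ -Real.log r) (-s⁻¹) s := fun hs ↦
    (Real.hasDerivAt_log hs).neg
  have hd1 : deriv (fun r : ℝ ↦ -Real.log r) (u x) = -(u x)⁻¹ := (hζ' hne).deriv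
  have hd2 : deriv (deriv fun r : ℝ ↦ -Real.log r) (u x) = ((u x) ^ 2)⁻¹ := by
    have hev : deriv (fun r : ℝ ↦ -Real.log r) =ᶠ[𝓝 (u x)] fun r ↦ -r⁻¹ := by
      filter_upwards [isOpen_ne.mem_nhds hne] with r hr
      exact (hζ' hr).deriv
    rw [hev.deriv_eq]
    have h : HasDerivAt (fun r : ℝ ↦ -r⁻¹) (-(-((u x) ^ 2)⁻¹)) (u x) := (hasDerivAt_inv hne).neg
    rw [h.deriv]
    ring
  have hΔ := g.dalembertian_real_comp (ζ := fun s : ℝ ↦ -Real.log s) hux2 hζ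
  rw [show (fun y ↦ -Real.log (u y)) = (fun s : ℝ ↦ -Real.log s) ∘ u from rfl, hΔ, hd1, hd2,
    show g.innerDual x (mvfderiv (𝓡 n) u x : TangentSpace (𝓡 n) x →ₗ[ℝ] ℝ)
      (mvfderiv (𝓡 n) u x : TangentSpace (𝓡 n) x →ₗ[ℝ] ℝ) = g.gradSq u x from rfl]
  field_simp
  ring

omit [T2Space M] [SecondCountableTopology M] [ConnectedSpace M] [T3Space M] [MeasurableSpace M]
  [BorelSpace M] in
/-- **Pointwise bound for `u Δ_g log u` along the flow on a shrinker**: for `u ∈ [a, b]`, `a > 0`,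
`|∇u|² ≤ CG`, `|Lu| ≤ CL`, `dV = df` and `|∇f|² ≤ f`:
`|u Δ_g(−log u)| ≤ CG/a + CL + (f + CG)/2` (`Δu = Lu + g⁻¹(df, du)`, Cauchy–Schwarz). [folklore] -/
theorem abs_dalembertian_negLog_mul_le (hg : g.IsRiemannian)
    (hnorm : ∀ x : M, g.scalarCurvature x + g.gradSq f x = f x) (hS : ∀ x, 0 ≤ g.scalarCurvature x)
    {V : M → ℝ} (hdV : ∀ x, mvfderiv (𝓡 n) V x = mvfderiv (𝓡 n) f x)
    {u : M → ℝ} (hu : ContMDiff (𝓡 n) 𝓘(ℝ, ℝ) ∞ u) {a b : ℝ} (ha : 0 < a)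
    (hab : ∀ x, a ≤ u x ∧ u x ≤ b) {CL : ℝ} (hLu : ∀ x, |g.dalembertian u x
      - g.innerDual x (mvfderiv (𝓡 n) V x : TangentSpace (𝓡 n) x →ₗ[ℝ] ℝ)
          (mvfderiv (𝓡 n) u x : TangentSpace (𝓡 n) x →ₗ[ℝ] ℝ)| ≤ CL)
    {CG : ℝ} (hGu : ∀ x, g.gradSq u x ≤ CG) (x : M) :
    |g.dalembertian (fun y ↦ -Real.log (u y)) x * u x| ≤ CG / a + CL + (f x + CG) / 2 := by
  have hupos : ∀ x, 0 < u x := fun x ↦ ha.trans_le (hab x).1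
  have hgradle : ∀ x, g.gradSq f x ≤ f x := fun x ↦ by linarith [hnorm x, hS x]
  rw [dalembertian_negLog_mul hu hupos x]
  have h1 : |g.gradSq u x / u x| ≤ CG / a := by
    rw [abs_of_nonneg (div_nonneg (g.gradSq_nonneg hg u x) (hupos x).le)]
    exact div_le_div₀ ((g.gradSq_nonneg hg u x).trans (hGu x)) (hGu x) ha (hab x).1
  have hcs := abs_innerDual_mvfderiv_le hg f u x
  have hcs' : |g.innerDual x (mvfderiv (𝓡 n) V x : TangentSpace (𝓡 n) x →ₗ[ℝ] ℝ)
      (mvfderiv (𝓡 n) u x : TangentSpace (𝓡 n) x →ₗ[ℝ] ℝ)| ≤ (f x + CG) / 2 := by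
    rw [hdV x]
    linarith [hgradle x, hGu x]
  have h2 : |g.dalembertian u x| ≤ CL + (f x + CG) / 2 := by
    have := hLu x
    have habs := abs_sub_abs_le_abs_sub (g.dalembertian u x)
      (g.innerDual x (mvfderiv (𝓡 n) V x : TangentSpace (𝓡 n) x →ₗ[ℝ] ℝ)
        (mvfderiv (𝓡 n) u x : TangentSpace (𝓡 n) x →ₗ[ℝ] ℝ))
    linarith
  calc |g.gradSq u x / u x - g.dalembertian u x|
      ≤ |g.gradSq u x / u x| + |g.dalembertian u x| := abs_sub _ _
    _ ≤ CG / a + CL + (f x + CG) / 2 := by linarith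

/-- **`∫ u Δ_g(−log u) e^{-V} = I(u) + (n/2)∫ u e^{-V} − ∫ f u e^{-V}`** on a complete gradient
shrinker (`integral_dalembertian_log_mul` with the sign of `−log`).
[cite: LiWang2020, proof of Prop. 5.7 and Lemma 5.10 (arXiv p. 20)] -/
theorem integral_dalembertian_negLog_mul (hg : g.IsRiemannian)
    (hc : ∀ (x : M) (r : NNReal), IsCompact {y : M | g.edist hg x y ≤ r})
    (hf : ContMDiff (𝓡 n) 𝓘(ℝ, ℝ) ∞ f)
    (hsol : ∀ (x : M) (X Y : TangentSpace (𝓡 n) x),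
      g.ricci x X Y + g.hessian f x X Y = (1 / 2 : ℝ) * g.val x X Y)
    (hnorm : ∀ x : M, g.scalarCurvature x + g.gradSq f x = f x)
    (hS : ∀ x, 0 ≤ g.scalarCurvature x) (hprop : ∀ c : ℝ, IsCompact {x | f x ≤ c})
    {V : M → ℝ} (hV : ContMDiff (𝓡 n) 𝓘(ℝ, ℝ) ∞ V) (hdV : ∀ x, mvfderiv (𝓡 n) V x = mvfderiv (𝓡 n) f x)
    (hw : Integrable (fun x ↦ Real.exp (-V x)) g.riemVolume)
    (hfw : Integrable (fun x ↦ f x * Real.exp (-V x)) g.riemVolume)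
    {u : M → ℝ} (hu : ContMDiff (𝓡 n) 𝓘(ℝ, ℝ) ∞ u) {a b : ℝ} (ha : 0 < a)
    (hab : ∀ x, a ≤ u x ∧ u x ≤ b) {CL : ℝ} (hLu : ∀ x, |g.dalembertian u x
      - g.innerDual x (mvfderiv (𝓡 n) V x : TangentSpace (𝓡 n) x →ₗ[ℝ] ℝ)
          (mvfderiv (𝓡 n) u x : TangentSpace (𝓡 n) x →ₗ[ℝ] ℝ)| ≤ CL)
    {CG : ℝ} (hGu : ∀ x, g.gradSq u x ≤ CG) :
    ∫ x, g.dalembertian (fun y ↦ -Real.log (u y)) x * u x * Real.exp (-V x) ∂g.riemVolume =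
      (∫ x, g.gradSq u x / u x * Real.exp (-V x) ∂g.riemVolume)
        + (n : ℝ) / 2 * (∫ x, u x * Real.exp (-V x) ∂g.riemVolume)
        - ∫ x, f x * u x * Real.exp (-V x) ∂g.riemVolume := by
  have hupos : ∀ x, 0 < u x := fun x ↦ ha.trans_le (hab x).1
  have h := integral_dalembertian_log_mul hg hc hf hsol hnorm hS hprop hV hdV hw hfw hu ha hab hLu hGu
  have hpt : ∀ x, g.dalembertian (fun y ↦ -Real.log (u y)) x * u x * Real.exp (-V x) =
      -(g.dalembertian (fun y ↦ Real.log (u y)) x * u x * Real.exp (-V x)) := fun x ↦ by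
    rw [dalembertian_negLog_eq hu hupos x]; ring
  simp_rw [hpt]
  rw [integral_neg, h]
  ring

end NegLog

namespace LiWang2020

/-! ### The scale function `τ(t) = 1 + (τ₀ − 1) e^{-t}` (Li–Wang's `θ(t) = (η₀ − t)/(1 − t)` in the
static time `s = log (1 − t)⁻¹`) -/

/-- `τ(t) = 1 + (τ₀ − 1)e^{-t}` solves `τ' = 1 − τ`. [cite: LiWang2020, Lemma 5.10, (PK08_7) (arXiv p. 20)] -/
theorem hasDerivAt_scale (τ₀ t : ℝ) :
    HasDerivAt (fun s ↦ 1 + (τ₀ - 1) * Real.exp (-s))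
      (1 - (1 + (τ₀ - 1) * Real.exp (-t))) t := by
  have h : HasDerivAt (fun s ↦ Real.exp (-s)) (-Real.exp (-t)) t := by
    simpa using ((hasDerivAt_id t).neg).exp
  exact ((h.const_mul (τ₀ - 1)).const_add 1).congr_deriv (by ring)

/-- `τ(t) ≥ min τ₀ 1 > 0` for `t ≥ 0`, `τ₀ > 0`. [folklore] -/
theorem min_le_scale {τ₀ t : ℝ} (ht : 0 ≤ t) : min τ₀ 1 ≤ 1 + (τ₀ - 1) * Real.exp (-t) := by
  have he0 : 0 < Real.exp (-t) := Real.exp_pos _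
  have he1 : Real.exp (-t) ≤ 1 := Real.exp_le_one_iff.2 (by linarith)
  rcases le_or_gt 1 τ₀ with h | h
  · rw [min_eq_right h]; nlinarith
  · rw [min_eq_left h.le]; nlinarith

/-- `τ(t) ≤ max τ₀ 1` for `t ≥ 0`. [folklore] -/
theorem scale_le_max {τ₀ t : ℝ} (ht : 0 ≤ t) : 1 + (τ₀ - 1) * Real.exp (-t) ≤ max τ₀ 1 := by
  have he0 : 0 < Real.exp (-t) := Real.exp_pos _
  have he1 : Real.exp (-t) ≤ 1 := Real.exp_le_one_iff.2 (by linarith)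
  rcases le_or_gt 1 τ₀ with h | h
  · rw [max_eq_left h]; nlinarith
  · rw [max_eq_right h.le]; nlinarith

/-- `|1 − τ(t)| ≤ |τ₀ − 1|` for `t ≥ 0`. [folklore] -/
theorem abs_one_sub_scale_le {τ₀ t : ℝ} (ht : 0 ≤ t) :
    |1 - (1 + (τ₀ - 1) * Real.exp (-t))| ≤ |τ₀ - 1| := by
  have he0 : 0 < Real.exp (-t) := Real.exp_pos _
  have he1 : Real.exp (-t) ≤ 1 := Real.exp_le_one_iff.2 (by linarith)
  rw [show 1 - (1 + (τ₀ - 1) * Real.exp (-t)) = -((τ₀ - 1) * Real.exp (-t)) by ring, abs_neg,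
    abs_mul, abs_of_pos he0]
  exact mul_le_of_le_one_right (abs_nonneg _) he1

/-- `τ(t) → 1` as `t → ∞`. [folklore] -/
theorem tendsto_scale (τ₀ : ℝ) :
    Tendsto (fun t ↦ 1 + (τ₀ - 1) * Real.exp (-t)) atTop (𝓝 1) := by
  have h : Tendsto (fun t : ℝ ↦ Real.exp (-t)) atTop (𝓝 0) := Real.tendsto_exp_neg_atTop_nhds_zero
  simpa using (h.const_mul (τ₀ - 1)).const_add 1

/-! ### The completed square of Perelman's entropy formula in the static frame -/

/-- **The algebraic heart of the monotonicity**: with `σ = 1 − τ`, `τ > 0`, `n > 0` and the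
Cauchy–Schwarz input `Y² ≤ D` (`Y = ∫ ρ Δ_g log ρ`, `D = ∫ ρ (Δ_g log ρ)²`),
`−(2τ/n) D + 2σ Y − (n/2) σ²/τ ≤ 0` — it is `−(2τ/n)(Y − nσ/2τ)² − (2τ/n)(D − Y²)`, the static-frame
form of Perelman's square `|Rc + Hess f − g/2τ|²` traced. [cite: LiWang2020, Thm. 4.3 and Lemma 5.10 (arXiv pp. 14–20)] -/
theorem perelman_square_nonpos {n τ Y D : ℝ} (hn : 0 < n) (hτ : 0 < τ) (hYD : Y ^ 2 ≤ D) :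
    -(2 * τ / n) * D + 2 * (1 - τ) * Y - n / 2 * (1 - τ) ^ 2 / τ ≤ 0 := by
  have h1 : -(2 * τ / n) * D ≤ -(2 * τ / n) * Y ^ 2 := by
    have : 0 < 2 * τ / n := by positivity
    nlinarith
  have h2 : -(2 * τ / n) * Y ^ 2 + 2 * (1 - τ) * Y - n / 2 * (1 - τ) ^ 2 / τ ≤ 0 := by
    have key : -(2 * τ / n) * Y ^ 2 + 2 * (1 - τ) * Y - n / 2 * (1 - τ) ^ 2 / τ =
        -(2 / (n * τ)) * (τ * Y - n * (1 - τ) / 2) ^ 2 := by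
      field_simp
      ring
    rw [key]
    have : 0 < 2 / (n * τ) := by positivity
    nlinarith [sq_nonneg (τ * Y - n * (1 - τ) / 2)]
  linarith

/-! ### Comparison: a derivative bound on `(0, ∞)` plus continuity at `0` -/

/-- If `Ψ` is continuous on `[0, ∞)`, differentiable on `(0, ∞)` with `Ψ' ≤ ε` there, then
`Ψ(T) ≤ Ψ(0) + ε T` for every `T ≥ 0`. [folklore] -/
theorem le_add_mul_of_deriv_le {Ψ Ψ' : ℝ → ℝ} {ε : ℝ} (hc : ContinuousOn Ψ (Ici 0))
    (hd : ∀ t : ℝ, 0 < t → HasDerivAt Ψ (Ψ' t) t) (hle : ∀ t : ℝ, 0 < t → Ψ' t ≤ ε)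
    {T : ℝ} (hT : 0 ≤ T) : Ψ T ≤ Ψ 0 + ε * T := by
  -- `m(t) = Ψ(t) − ε t` is antitone on `[0, T]`
  set m : ℝ → ℝ := fun t ↦ Ψ t - ε * t with hm
  have hmc : ContinuousOn m (Icc 0 T) :=
    (hc.mono Icc_subset_Ici_self).sub (continuousOn_const.mul continuousOn_id)
  have hmd : ∀ t ∈ interior (Icc 0 T), HasDerivWithinAt m (Ψ' t - ε) (interior (Icc 0 T)) t := by
    intro t ht
    rw [interior_Icc] at ht
    have h := (hd t ht.1).sub ((hasDerivAt_id t).const_mul ε)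
    simp only [mul_one] at h
    exact h.hasDerivWithinAt
  have hanti : AntitoneOn m (Icc 0 T) := by
    refine antitoneOn_of_hasDerivWithinAt_nonpos (convex_Icc 0 T) hmc hmd ?_
    intro t ht
    rw [interior_Icc] at ht
    linarith [hle t ht.1]
  have h := hanti (left_mem_Icc.2 hT) (right_mem_Icc.2 hT) hT
  simp only [hm, mul_zero, sub_zero] at h
  linarith

/-! ### The double limit: cut-off index `N → ∞`, then time `T → ∞` -/

/-- **Endgame of the monotonicity argument**: suppose `Ψ_N(T) ≤ Ψ_N(0) + ε_N T` for all `N` and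
`T ≥ 0`, `Ψ_N(t) → Φ(t)` for each `t ≥ 0`, `ε_N → 0`, `Φ(T) ≥ γ(T)` for `T ≥ 0` and `γ(T) → 0` as
`T → ∞`. Then `0 ≤ Φ(0)`. [folklore] -/
theorem nonneg_of_monotonicity {Ψ : ℕ → ℝ → ℝ} {Φ γ : ℝ → ℝ} {ε : ℕ → ℝ}
    (hstep : ∀ N : ℕ, ∀ T : ℝ, 0 ≤ T → Ψ N T ≤ Ψ N 0 + ε N * T)
    (hlimN : ∀ t : ℝ, 0 ≤ t → Tendsto (fun N ↦ Ψ N t) atTop (𝓝 (Φ t)))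
    (hε : Tendsto ε atTop (𝓝 0)) (hlow : ∀ T : ℝ, 0 ≤ T → γ T ≤ Φ T)
    (hγ : Tendsto γ atTop (𝓝 0)) : 0 ≤ Φ 0 := by
  -- `Φ(T) ≤ Φ(0)` for `T ≥ 0`
  have hmono : ∀ T : ℝ, 0 ≤ T → Φ T ≤ Φ 0 := by
    intro T hT
    have h1 : Tendsto (fun N ↦ Ψ N T) atTop (𝓝 (Φ T)) := hlimN T hT
    have h2 : Tendsto (fun N ↦ Ψ N 0 + ε N * T) atTop (𝓝 (Φ 0 + 0 * T)) :=
      (hlimN 0 le_rfl).add (hε.mul_const T)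
    rw [zero_mul, add_zero] at h2
    exact le_of_tendsto_of_tendsto' h1 h2 fun N ↦ hstep N T hT
  -- `γ(T) ≤ Φ(0)` eventually, `γ → 0`
  have hev : ∀ᶠ T in atTop, γ T ≤ Φ 0 :=
    (eventually_ge_atTop (0 : ℝ)).mono fun T hT ↦ (hlow T hT).trans (hmono T hT)
  exact le_of_tendsto hγ hev

end LiWang2020

/-! ### The static-frame Perelman monotonicity along the semigroup -/

section Flow

variable {n : ℕ} {M : Type uM} [TopologicalSpace M] [T2Space M] [SecondCountableTopology M]
  [ChartedSpace (EuclideanSpace ℝ (Fin n)) M] [IsManifold (𝓡 n) ∞ M] [ConnectedSpace M]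
  [T3Space M] [MeasurableSpace M] [BorelSpace M]
  {g : PseudoRiemannianMetric (𝓡 n) ∞ (EuclideanSpace ℝ (Fin n)) (TangentSpace (𝓡 n) : M → Type _)}
  [g.HasLeviCivita]

-- one long flow computation (Li–Wang's Lemma 5.10 with cut-offs); splitting it would multiply the
-- shared set-up (the flow and its a-priori bounds) across a dozen statements
set_option maxHeartbeats 1600000 in
/-- **Li–Wang's logarithmic Sobolev inequality at every scale, for one initial density, from ITS
weighted heat flow** (Li–Wang 2020, Thm. 1.1 via Thm. 4.3/Thm. 4.5, Prop. 5.7/5.9 and Lemma 5.10,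
in the static frame) — the form of `shrinker_asei_eventuallyConst_of_semigroup` whose analytic
input is only the solution `u` of `∂ₜu = Lu = Δu − g⁻¹(dV, du)` started at `e^φ`, with its
a-priori properties. On a complete connected gradient shrinker `Ric + Hess f = g/2`,
`R + |∇f|² = f` (`R ≥ 0`, `f` proper, `n ≥ 1`) with weight `e^{-V}`, `V = f + c`, `∫ e^{-V} = 1`,
let `u : [0, ∞) × M → [a, b]` (`a > 0`) be jointly smooth on `M × [0, ∞)`, solve the weighted heat
equation (one-sided time derivative within `[0, ∞)`), have `|Lu| ≤ C_L`, the Bakry–Émery gradient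
decay `|∇u(t)|² ≤ e^{-t} C_Γ` (`K = 1/2`) and unit mass `∫ u(t) e^{-V} = 1`, and start at
`u(0) = e^φ`, `φ` smooth. Then, for every `τ₀ > 0`,
`∫ φ e^φ e^{-V} ≤ τ₀ ∫ |∇φ|² e^φ e^{-V} + (1 − τ₀)(∫ f e^φ e^{-V} − n) − (n/2) log τ₀`.
These hypotheses are supplied by the semigroup of `weightedHeatSemigroup_strongGradientBound_complete`
(`shrinker_asei_eventuallyConst_of_semigroup`) and equally by any construction of the weighted heat
flow on the complete shrinker with maximum principle, mass conservation and gradient bound (the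
linear parabolic theory of Li–Wang's §§2–3).
Proof (Li–Wang's Lemma 5.10 pulled back by the self-similar diffeomorphisms, i.e. Perelman's
entropy monotonicity written along the static flow `u(t)`, `τ(t) = 1 + (τ₀ − 1)e^{-t}`):
with `H = ∫ u log u`, `I = ∫ |∇u|²/u`, `F = ∫ f u` (all against `e^{-V}`) and Li–Wang's cut-offs
`χ_r = η(f/r)`, the cut-off functional `Ψ_r = τ I_r − H + (1 − τ)(F − n) − (n/2) log τ`
(`I_r = ∫ χ_r |∇u|²/u`) satisfies `Ψ_r' ≤ −(2τ/n)(Y_r − n(1−τ)/2τ)² + O(1/r) ≤ C/r` by the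
dimensional Bochner inequality for the Fisher density (`fisherDensity_pointwise_le_dim`), the
symmetry `∫ χ LQ = ∫ Q Lχ`, Cauchy–Schwarz `Y_r² ≤ D_r`, `dH/dt = −I`, `dF/dt = n/2 − F` and the
identity `∫ u Δ log u = −I − n/2 + F`; letting `r → ∞` and then `t → ∞` (`H → 0`, `τ → 1`,
`F` bounded) gives `Ψ(0) ≥ 0`, which is the claim.
[cite: LiWang2020, Thm. 1.1, Thm. 4.3, Prop. 5.9 and Lemma 5.10 (arXiv:1901.05691, pp. 3, 14, 20)] -/
theorem shrinker_asei_eventuallyConst_of_flow (hg : g.IsRiemannian)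
    (hc : ∀ (x : M) (r : NNReal), IsCompact {y : M | g.edist hg x y ≤ r}) (hn : 0 < n)
    {f : M → ℝ} (hf : ContMDiff (𝓡 n) 𝓘(ℝ, ℝ) ∞ f)
    (hsol : ∀ (x : M) (X Y : TangentSpace (𝓡 n) x),
      g.ricci x X Y + g.hessian f x X Y = (1 / 2 : ℝ) * g.val x X Y)
    (hnorm : ∀ x : M, g.scalarCurvature x + g.gradSq f x = f x)
    (hS : ∀ x, 0 ≤ g.scalarCurvature x) (hprop : ∀ c : ℝ, IsCompact {x | f x ≤ c})
    {V : M → ℝ} {cV : ℝ} (hVf : ∀ x, V x = f x + cV)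
    (hmass : ∫ x, Real.exp (-V x) ∂g.riemVolume = 1)
    (hfw : Integrable (fun x ↦ f x * Real.exp (-V x)) g.riemVolume)
    (u : ℝ → M → ℝ)
    (hu : ContMDiffOn ((𝓡 n).prod 𝓘(ℝ, ℝ)) 𝓘(ℝ, ℝ) ∞ (fun p : M × ℝ ↦ u p.2 p.1) (univ ×ˢ Ici 0))
    (hueq : ∀ t ∈ Ici (0 : ℝ), ∀ x, derivWithin (fun s ↦ u s x) (Ici 0) t =
      g.dalembertian (u t) x
        - g.innerDual x (mvfderiv (𝓡 n) V x : TangentSpace (𝓡 n) x →ₗ[ℝ] ℝ)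
            (mvfderiv (𝓡 n) (u t) x : TangentSpace (𝓡 n) x →ₗ[ℝ] ℝ))
    {a b : ℝ} (ha : 0 < a) (hab : ∀ t ∈ Ici (0 : ℝ), ∀ x, a ≤ u t x ∧ u t x ≤ b)
    {CL : ℝ} (hLu : ∀ t ∈ Ici (0 : ℝ), ∀ x, |g.dalembertian (u t) x
      - g.innerDual x (mvfderiv (𝓡 n) V x : TangentSpace (𝓡 n) x →ₗ[ℝ] ℝ)
          (mvfderiv (𝓡 n) (u t) x : TangentSpace (𝓡 n) x →ₗ[ℝ] ℝ)| ≤ CL)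
    {CΓ : ℝ} (hGdecay : ∀ t ∈ Ici (0 : ℝ), ∀ x, g.gradSq (u t) x ≤ Real.exp (-t) * CΓ)
    (hmassu : ∀ t ∈ Ici (0 : ℝ), ∫ x, u t x * Real.exp (-V x) ∂g.riemVolume = 1)
    {τ₀ : ℝ} (hτ₀ : 0 < τ₀) (φ : M → ℝ) (hφ : ContMDiff (𝓡 n) 𝓘(ℝ, ℝ) ∞ φ)
    (hu0 : u 0 = fun x ↦ Real.exp (φ x)) :
    ∫ x, φ x * (Real.exp (φ x) * Real.exp (-V x)) ∂g.riemVolume ≤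
      τ₀ * ∫ x, g.gradSq φ x * (Real.exp (φ x) * Real.exp (-V x)) ∂g.riemVolume
        + (1 - τ₀) * (∫ x, f x * (Real.exp (φ x) * Real.exp (-V x)) ∂g.riemVolume - n)
        - n / 2 * Real.log τ₀ := by
  haveI : Nonempty M := ConnectedSpace.toNonempty
  obtain ⟨o⟩ := ‹Nonempty M›
  haveI : LocallyCompactSpace M := Manifold.locallyCompact_of_finiteDimensional (𝓡 n)
  haveI := isFiniteMeasureOnCompacts_riemVolume (g := g) hg
  have hSU : UniqueDiffOn ℝ (Ici (0 : ℝ)) := uniqueDiffOn_Ici 0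
  have hS' : Ici (0 : ℝ) ⊆ closure (interior (Ici 0)) := fun t ht ↦ by
    rw [interior_Ici, closure_Ioi]; exact ht
  have hnr : (0 : ℝ) < n := Nat.cast_pos.2 hn
  /- the weight `e^{-V}`, `V = f + cV` -/
  have hw : Integrable (fun x ↦ Real.exp (-V x)) g.riemVolume := by
    by_contra h'; rw [integral_undef h'] at hmass; exact zero_ne_one hmass
  have hw0 : ∀ x, 0 ≤ Real.exp (-V x) := fun x ↦ (Real.exp_pos _).le
  have hVeq : V = fun x ↦ f x + cV := funext hVf
  have hV : ContMDiff (𝓡 n) 𝓘(ℝ, ℝ) ∞ V := by rw [hVeq]; exact hf.add contMDiff_const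
  have hV1 : ContMDiff (𝓡 n) 𝓘(ℝ, ℝ) 1 V := hV.of_le (by norm_num)
  have hwc : Continuous fun x ↦ Real.exp (-V x) := Real.continuous_exp.comp hV.continuous.neg
  have hdV : ∀ x, mvfderiv (𝓡 n) V x = mvfderiv (𝓡 n) f x := by
    intro x; rw [hVeq]; exact mvfderiv_add_const_eq hf cV x
  have hRic : ∀ (x : M) (X : TangentSpace (𝓡 n) x),
      (1 / 2 : ℝ) * g.val x X X ≤ g.ricci x X X + g.hessian V x X X := by
    intro x X
    rw [hVeq, hessian_add_const_apply hf cV x X X]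
    exact (hsol x X X).symm.le
  have hf0 : ∀ x, 0 ≤ f x := fun x ↦ by linarith [hnorm x, hS x, g.gradSq_nonneg hg f x]
  have hexpV : ∀ x, Real.exp (-V x) = Real.exp (-cV) * Real.exp (-f x) := fun x ↦ by
    rw [hVf x, show -(f x + cV) = -cV + -f x by ring, Real.exp_add]
  -- `f² e^{-V} ∈ L¹`
  have hfwf : Integrable (fun x ↦ f x * Real.exp (-f x)) g.riemVolume := by
    refine (hfw.const_mul (Real.exp cV)).congr (Eventually.of_forall fun x ↦ ?_)
    show Real.exp cV * (f x * Real.exp (-V x)) = f x * Real.exp (-f x)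
    rw [hexpV x]
    have h : Real.exp cV * Real.exp (-cV) = 1 := by
      rw [← Real.exp_add, add_neg_cancel, Real.exp_zero]
    linear_combination (f x * Real.exp (-f x)) * h
  have hf2w : Integrable (fun x ↦ f x ^ 2 * Real.exp (-V x)) g.riemVolume := by
    refine ((integrable_sq_potential_mul_exp_neg hg hf hsol hnorm hS hprop hfwf).const_mul
      (Real.exp (-cV))).congr (Eventually.of_forall fun x ↦ ?_)
    show Real.exp (-cV) * (f x ^ 2 * Real.exp (-f x)) = f x ^ 2 * Real.exp (-V x)
    rw [hexpV x]; ring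
  /- the datum `ρ = e^φ` -/
  set ρ : M → ℝ := fun x ↦ Real.exp (φ x) with hρdef
  have hΓρ : ∀ x, g.gradSq ρ x = ρ x ^ 2 * g.gradSq φ x := fun x ↦ by
    have hh : HasDerivAt Real.exp (Real.exp (φ x)) (φ x) := Real.hasDerivAt_exp _
    exact g.gradSq_real_comp hh (hφ.mdifferentiableAt (by simp))
  /- the a-priori bounds of the flow -/
  have hCL0 : 0 ≤ CL := (abs_nonneg _).trans (hLu 0 (mem_Ici.2 le_rfl) o)
  have hCΓ0 : 0 ≤ CΓ := by
    have h := hGdecay 0 (mem_Ici.2 le_rfl) o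
    rw [neg_zero, Real.exp_zero, one_mul] at h
    exact (g.gradSq_nonneg hg _ o).trans h
  have hupos : ∀ t ∈ Ici (0 : ℝ), ∀ x, 0 < u t x := fun t ht x ↦ ha.trans_le (hab t ht x).1
  have hub : ∀ t ∈ Ici (0 : ℝ), ∀ x, |u t x| ≤ b := fun t ht x ↦ by
    rw [abs_of_pos (hupos t ht x)]; exact (hab t ht x).2
  have hGu' : ∀ t ∈ Ici (0 : ℝ), ∀ x, g.gradSq (u t) x ≤ (Real.exp (-(1 / 2 : ℝ) * t)) ^ 2 * CΓ := by
    intro t ht x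
    have h1 : (Real.exp (-(1 / 2 : ℝ) * t)) ^ 2 = Real.exp (-t) := by
      rw [sq, ← Real.exp_add]; congr 1; ring
    rw [h1]
    exact hGdecay t ht x
  have hGu : ∀ t ∈ Ici (0 : ℝ), ∀ x, g.gradSq (u t) x ≤ CΓ := by
    intro t ht x
    refine (hGdecay t ht x).trans (mul_le_of_le_one_left hCΓ0 ?_)
    exact Real.exp_le_one_iff.2 (by linarith [mem_Ici.1 ht])
  have huc1 : ∀ t ∈ Ici (0 : ℝ), ContMDiff (𝓡 n) 𝓘(ℝ, ℝ) 1 (u t) := fun t ht ↦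
    (hu.comp_contMDiff (contMDiff_id.prodMk contMDiff_const) fun y ↦ ⟨mem_univ _, ht⟩).of_le
      (by norm_num)
  have hslice : ∀ t ∈ Ici (0 : ℝ), ContMDiff (𝓡 n) 𝓘(ℝ, ℝ) ∞ (u t) := fun t ht ↦
    hu.comp_contMDiff (contMDiff_id.prodMk contMDiff_const) fun y ↦ ⟨mem_univ _, ht⟩
  /- entropy, Fisher information and the potential moment along the flow -/
  set Hf : ℝ → ℝ := fun s ↦ ∫ x, u s x * Real.log (u s x) * Real.exp (-V x) ∂g.riemVolume
    with hHfdef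
  set If : ℝ → ℝ := fun s ↦ ∫ x, g.gradSq (u s) x / u s x * Real.exp (-V x) ∂g.riemVolume
    with hIfdef
  set Ff : ℝ → ℝ := fun s ↦ ∫ x, f x * u s x * Real.exp (-V x) ∂g.riemVolume with hFfdef
  have hHd : ∀ t : ℝ, 0 < t → HasDerivAt Hf (-If t) t := fun t ht ↦
    hasDerivAt_entropy_complete hg hc hV hw hu hueq ha hab hLu hGu ht
  have hHc : ContinuousOn Hf (Ici 0) := continuousOn_entropy_complete hV hw hu ha hab
  have hHlim : Tendsto Hf atTop (𝓝 0) :=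
    tendsto_entropy_complete hg hV hw hmass huc1 ha hab one_half_pos hCΓ0 hGu' hmassu
  have hIf0 : ∀ t ∈ Ici (0 : ℝ), 0 ≤ If t := fun t ht ↦ integral_nonneg fun x ↦
    mul_nonneg (div_nonneg (g.gradSq_nonneg hg _ x) (hupos t ht x).le) (hw0 x)
  have hFd : ∀ t : ℝ, 0 < t → HasDerivAt Ff ((n : ℝ) / 2 - Ff t) t := by
    intro t ht
    have h := hasDerivAt_potentialMoment hg hf hsol hnorm hS hprop hV hdV hw hfw hf2w hu hueq hub
      hLu hGu ht
    have h' : HasDerivAt Ff ((n : ℝ) / 2 * (∫ x, u t x * Real.exp (-V x) ∂g.riemVolume) - Ff t) t := h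
    rw [hmassu t (le_of_lt ht), mul_one] at h'
    exact h'
  have hFc : ContinuousOn Ff (Ici 0) := continuousOn_potentialMoment hV hf hfw hu hub
  set M₁ : ℝ := ∫ x, f x * Real.exp (-V x) ∂g.riemVolume with hM₁def
  set M₂ : ℝ := ∫ x, f x ^ 2 * Real.exp (-V x) ∂g.riemVolume with hM₂def
  have hM₁0 : 0 ≤ M₁ := integral_nonneg fun x ↦ mul_nonneg (hf0 x) (hw0 x)
  have hM₂0 : 0 ≤ M₂ := integral_nonneg fun x ↦ mul_nonneg (sq_nonneg _) (hw0 x)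
  have hFbd : ∀ t ∈ Ici (0 : ℝ), |Ff t| ≤ b * M₁ := by
    intro t ht
    have hbd : ∀ x, ‖f x * u t x * Real.exp (-V x)‖ ≤ b * ‖f x * Real.exp (-V x)‖ := fun x ↦
      abs_mul_mul_le_of_abs_le (hub t ht x)
    have h := norm_integral_le_of_norm_le (hfw.norm.const_mul b) (Eventually.of_forall hbd)
    have h2 : ∫ x, ‖f x * Real.exp (-V x)‖ ∂g.riemVolume = M₁ :=
      integral_congr_ae (Eventually.of_forall fun x ↦ by
        show ‖f x * Real.exp (-V x)‖ = f x * Real.exp (-V x)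
        rw [Real.norm_eq_abs, abs_of_nonneg (mul_nonneg (hf0 x) (hw0 x))])
    rw [integral_const_mul, h2] at h
    simpa only [Real.norm_eq_abs] using h
  /- `ℓ = −log u`, the Fisher density `Q = |∇ℓ|² e^{-ℓ}` and the Laplacian `A = Δ_g ℓ` -/
  set ℓ : ℝ → M → ℝ := fun t y ↦ -Real.log (u t y) with hℓdef
  have hℓ : ContMDiffOn ((𝓡 n).prod 𝓘(ℝ, ℝ)) 𝓘(ℝ, ℝ) ∞ (fun p : M × ℝ ↦ ℓ p.2 p.1)
      (univ ×ˢ Ici 0) := by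
    intro p hp
    have hne : u p.2 p.1 ≠ 0 := (hupos p.2 hp.2 p.1).ne'
    exact ((Real.contDiffAt_log.2 hne).comp_contMDiffWithinAt
      (f := fun p : M × ℝ ↦ u p.2 p.1) (x := p) (hu p hp)).neg
  have hℓs : ∀ t ∈ Ici (0 : ℝ), ContMDiff (𝓡 n) 𝓘(ℝ, ℝ) ∞ (ℓ t) := fun t ht ↦
    hℓ.comp_contMDiff (contMDiff_id.prodMk contMDiff_const) fun y ↦ ⟨mem_univ _, ht⟩
  have heqℓ : ∀ t ∈ Ici (0 : ℝ), ∀ y : M, derivWithin (fun s ↦ ℓ s y) (Ici 0) t =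
      g.dalembertian (ℓ t) y
        - g.innerDual y (mvfderiv (𝓡 n) V y : TangentSpace (𝓡 n) y →ₗ[ℝ] ℝ)
            (mvfderiv (𝓡 n) (ℓ t) y : TangentSpace (𝓡 n) y →ₗ[ℝ] ℝ)
        - g.gradSq (ℓ t) y := by
    intro t ht y
    have hut : ContMDiffAt (𝓡 n) 𝓘(ℝ, ℝ) 2 (u t) y :=
      ((hslice t ht).of_le (WithTop.coe_le_coe.mpr le_top)).contMDiffAt
    exact negLog_heat_equation g hut (hupos t ht y)
      (hasDerivWithinAt_time_of_contMDiffOn (k := ∞) (by simp) hu y ht) (hSU t ht) (hueq t ht y)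
  have hexpℓ : ∀ t ∈ Ici (0 : ℝ), ∀ y, Real.exp (-ℓ t y) = u t y := fun t ht y ↦ by
    simp only [hℓdef, neg_neg, Real.exp_log (hupos t ht y)]
  set Q : ℝ → M → ℝ := fun t y ↦ g.gradSq (ℓ t) y * Real.exp (-ℓ t y) with hQdef
  have hQ : ContMDiffOn ((𝓡 n).prod 𝓘(ℝ, ℝ)) 𝓘(ℝ, ℝ) ∞ (fun p : M × ℝ ↦ Q p.2 p.1)
      (univ ×ˢ Ici 0) := by
    intro p hp
    have h1 := (contMDiffOn_gradSq_family g hSU hℓ) p hp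
    have h2 : ContMDiffWithinAt ((𝓡 n).prod 𝓘(ℝ, ℝ)) 𝓘(ℝ, ℝ) ∞
        (fun p : M × ℝ ↦ Real.exp (-ℓ p.2 p.1)) (univ ×ˢ Ici 0) p :=
      Real.contDiff_exp.contDiffAt.comp_contMDiffWithinAt (hℓ p hp).neg
    exact h1.mul h2
  have hQs : ∀ t ∈ Ici (0 : ℝ), ContMDiff (𝓡 n) 𝓘(ℝ, ℝ) ∞ (Q t) := fun t ht ↦
    hQ.comp_contMDiff (contMDiff_id.prodMk contMDiff_const) fun y ↦ ⟨mem_univ _, ht⟩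
  have hQu : ∀ t ∈ Ici (0 : ℝ), ∀ y, Q t y = g.gradSq (u t) y / u t y := by
    intro t ht y
    have hne : u t y ≠ 0 := (hupos t ht y).ne'
    have hζ' : HasDerivAt (fun r : ℝ ↦ -Real.log r) (-(u t y)⁻¹) (u t y) :=
      (Real.hasDerivAt_log hne).neg
    have hgrad : g.gradSq (ℓ t) y = (-(u t y)⁻¹) ^ 2 * g.gradSq (u t) y :=
      g.gradSq_real_comp hζ' ((hslice t ht).mdifferentiableAt (by simp))
    simp only [hQdef]
    rw [hexpℓ t ht y, hgrad]
    field_simp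
  have hQbd : ∀ t ∈ Ici (0 : ℝ), ∀ y, 0 ≤ Q t y ∧ Q t y ≤ CΓ / a := by
    intro t ht y
    rw [hQu t ht y]
    exact ⟨div_nonneg (g.gradSq_nonneg hg _ y) (hupos t ht y).le,
      div_le_div₀ hCΓ0 (hGu t ht y) ha (hab t ht y).1⟩
  have hIQ : ∀ t ∈ Ici (0 : ℝ), If t = ∫ y, Q t y * Real.exp (-V y) ∂g.riemVolume := fun t ht ↦
    integral_congr_ae (Eventually.of_forall fun y ↦ by simp only [hQu t ht y])
  set A : ℝ → M → ℝ := fun t y ↦ g.dalembertian (ℓ t) y with hAdef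
  have hAc : ∀ t ∈ Ici (0 : ℝ), Continuous (A t) := fun t ht ↦
    continuous_dalembertian g ((hℓs t ht).of_le (WithTop.coe_le_coe.mpr le_top))
  set C₁ : ℝ := CΓ / a + CL + CΓ / 2 with hC₁def
  have hC₁0 : 0 ≤ C₁ := by positivity
  have hAu : ∀ t ∈ Ici (0 : ℝ), ∀ y, |A t y * u t y| ≤ C₁ + f y / 2 := by
    intro t ht y
    have h := abs_dalembertian_negLog_mul_le hg hnorm hS hdV (hslice t ht) ha (hab t ht) (hLu t ht)
      (hGu t ht) y
    have h' : |A t y * u t y| ≤ CΓ / a + CL + (f y + CΓ) / 2 := h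
    simp only [hC₁def]; linarith
  -- the identity `∫ u Δ_g ℓ e^{-V} = I + n/2 − F`
  have hX : ∀ t ∈ Ici (0 : ℝ), ∫ y, A t y * u t y * Real.exp (-V y) ∂g.riemVolume =
      If t + n / 2 - Ff t := by
    intro t ht
    have h := integral_dalembertian_negLog_mul hg hc hf hsol hnorm hS hprop hV hdV hw hfw
      (hslice t ht) ha (hab t ht) (hLu t ht) (hGu t ht)
    have h' : ∫ y, A t y * u t y * Real.exp (-V y) ∂g.riemVolume =
        If t + (n : ℝ) / 2 * (∫ x, u t x * Real.exp (-V x) ∂g.riemVolume) - Ff t := h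
    rw [hmassu t ht, mul_one] at h'
    exact h'
  /- Li–Wang's cut-offs `χ_N = η(f/(N+1))` -/
  obtain ⟨Ccut, hCcut0, χ, hχ⟩ := exists_shrinkerCutoff hg hf hsol hnorm hS hprop hdV
  have hNpos : ∀ N : ℕ, (0 : ℝ) < (N : ℝ) + 1 := fun N ↦ Nat.cast_add_one_pos N
  have hN1 : ∀ N : ℕ, (1 : ℝ) ≤ (N : ℝ) + 1 := fun N ↦ by
    have : (0 : ℝ) ≤ N := N.cast_nonneg
    linarith
  set χN : ℕ → M → ℝ := fun N ↦ χ ((N : ℝ) + 1) with hχNdef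
  have hχs : ∀ N, ContMDiff (𝓡 n) 𝓘(ℝ, ℝ) ∞ (χN N) := fun N ↦ (hχ _ (hN1 N)).1
  have hχc : ∀ N, HasCompactSupport (χN N) := fun N ↦ (hχ _ (hN1 N)).2.1
  have hχ01 : ∀ N x, 0 ≤ χN N x ∧ χN N x ≤ 1 := fun N ↦ (hχ _ (hN1 N)).2.2.1
  have hχ1 : ∀ (N : ℕ) x, f x ≤ (N : ℝ) + 1 → χN N x = 1 := fun N ↦ (hχ _ (hN1 N)).2.2.2.1
  set Lχ : ℕ → M → ℝ := fun N x ↦ g.dalembertian (χN N) x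
      - g.innerDual x (mvfderiv (𝓡 n) V x : TangentSpace (𝓡 n) x →ₗ[ℝ] ℝ)
          (mvfderiv (𝓡 n) (χN N) x : TangentSpace (𝓡 n) x →ₗ[ℝ] ℝ) with hLχdef
  have hχL : ∀ N x, |Lχ N x| ≤ Ccut := fun N ↦ (hχ _ (hN1 N)).2.2.2.2.1
  have hχL0 : ∀ (N : ℕ) x, f x < (N : ℝ) + 1 → Lχ N x = 0 := fun N ↦ (hχ _ (hN1 N)).2.2.2.2.2
  have h1χ : ∀ N x, 0 ≤ 1 - χN N x ∧ 1 - χN N x ≤ f x / ((N : ℝ) + 1) := by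
    intro N x
    refine ⟨by linarith [(hχ01 N x).2], ?_⟩
    by_cases hfx : f x ≤ (N : ℝ) + 1
    · rw [hχ1 N x hfx, sub_self]; exact div_nonneg (hf0 x) (hNpos N).le
    · have : 1 ≤ f x / ((N : ℝ) + 1) := by rw [le_div_iff₀ (hNpos N)]; linarith
      linarith [(hχ01 N x).1]
  have hLχf : ∀ N x, |Lχ N x| ≤ Ccut * (f x / ((N : ℝ) + 1)) := by
    intro N x
    by_cases hfx : f x < (N : ℝ) + 1
    · rw [hχL0 N x hfx, abs_zero]; exact mul_nonneg hCcut0 (div_nonneg (hf0 x) (hNpos N).le)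
    · have : 1 ≤ f x / ((N : ℝ) + 1) := by rw [le_div_iff₀ (hNpos N)]; linarith
      calc |Lχ N x| ≤ Ccut := hχL N x
        _ = Ccut * 1 := (mul_one _).symm
        _ ≤ Ccut * (f x / ((N : ℝ) + 1)) := mul_le_mul_of_nonneg_left this hCcut0
  have hχcont : ∀ N, Continuous (χN N) := fun N ↦ (hχs N).continuous
  have hLχc : ∀ N, Continuous (Lχ N) := fun N ↦
    (continuous_dalembertian g ((hχs N).of_le (WithTop.coe_le_coe.mpr le_top))).sub
      (continuous_innerDual_mvfderiv g hV1 ((hχs N).of_le (by norm_num)))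
  -- integrability of `χ_N F e^{-V}` for continuous `F`
  have iχ : ∀ N, ∀ {F : M → ℝ}, Continuous F →
      Integrable (fun y ↦ χN N y * F y * Real.exp (-V y)) g.riemVolume := fun N F hF ↦
    (((hχcont N).mul hF).mul hwc).integrable_of_hasCompactSupport ((hχc N).mul_right.mul_right)
  /- the cut-off Fisher information and its time derivative -/
  set IN : ℕ → ℝ → ℝ := fun N t ↦ ∫ y, χN N y * Q t y * Real.exp (-V y) ∂g.riemVolume with hINdef
  set Q' : ℝ → M → ℝ := fun t y ↦ derivWithin (fun s ↦ Q s y) (Ici 0) t with hQ'def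
  have hQ'c : ∀ t ∈ Ici (0 : ℝ), Continuous fun y ↦ Q' t y := fun t ht ↦
    continuous_slice_of_continuousOn_prod
      (contMDiffOn_derivWithin_time_of_uniqueDiffOn (u := Q) hSU hQ).continuousOn ht
  have hINd : ∀ N, ∀ t : ℝ, 0 < t →
      HasDerivAt (IN N) (∫ y, χN N y * Q' t y * Real.exp (-V y) ∂g.riemVolume) t :=
    fun N t ht ↦ hasDerivAt_integral_cutoff hg hQ (hχcont N) (hχc N) hwc ht
  have hINc : ∀ N, ContinuousOn (IN N) (Ici 0) := fun N ↦
    continuousOn_integral_cutoff hg hQ.continuousOn (hχcont N) (hχc N) hwc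
  set EN : ℕ → ℝ → ℝ := fun N t ↦ ∫ y, Q t y * Lχ N y * Real.exp (-V y) ∂g.riemVolume with hENdef
  set DN : ℕ → ℝ → ℝ := fun N t ↦
    ∫ y, χN N y * (A t y ^ 2 * Real.exp (-ℓ t y)) * Real.exp (-V y) ∂g.riemVolume with hDNdef
  set YN : ℕ → ℝ → ℝ := fun N t ↦
    ∫ y, χN N y * (A t y * Real.exp (-ℓ t y)) * Real.exp (-V y) ∂g.riemVolume with hYNdef
  -- the cut-off dissipation inequality `I_N' ≤ E_N − I_N − (2/n) D_N`
  have hdiss : ∀ N, ∀ t ∈ Ici (0 : ℝ),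
      ∫ y, χN N y * Q' t y * Real.exp (-V y) ∂g.riemVolume ≤ EN N t - IN N t - 2 / n * DN N t := by
    intro N t ht
    set LQ : M → ℝ := fun y ↦ g.dalembertian (Q t) y
        - g.innerDual y (mvfderiv (𝓡 n) V y : TangentSpace (𝓡 n) y →ₗ[ℝ] ℝ)
            (mvfderiv (𝓡 n) (Q t) y : TangentSpace (𝓡 n) y →ₗ[ℝ] ℝ) with hLQdef
    have hQt2 : ContMDiff (𝓡 n) 𝓘(ℝ, ℝ) 2 (Q t) := (hQs t ht).of_le (WithTop.coe_le_coe.mpr le_top)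
    have hLQc : Continuous LQ := (continuous_dalembertian g hQt2).sub
      (continuous_innerDual_mvfderiv g hV1 ((hQs t ht).of_le (by norm_num)))
    have hpt : ∀ y, χN N y * Q' t y * Real.exp (-V y) ≤
        χN N y * LQ y * Real.exp (-V y) - χN N y * Q t y * Real.exp (-V y)
          - 2 / n * (χN N y * (A t y ^ 2 * Real.exp (-ℓ t y)) * Real.exp (-V y)) := by
      intro y
      have h1 : Q' t y ≤ LQ y - 2 * (1 / 2 : ℝ) * Q t y
          - 2 / (finrank ℝ (EuclideanSpace ℝ (Fin n)) : ℝ) * A t y ^ 2 * Real.exp (-ℓ t y) :=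
        fisherDensity_pointwise_le_dim g hg hV hRic hSU hS' hℓ heqℓ y ht
      rw [finrank_euclideanSpace_fin] at h1
      have hχw : 0 ≤ χN N y * Real.exp (-V y) := mul_nonneg (hχ01 N y).1 (hw0 y)
      have h2 := mul_le_mul_of_nonneg_left h1 hχw
      linear_combination h2
    have iL : Integrable (fun y ↦ χN N y * Q' t y * Real.exp (-V y)) g.riemVolume :=
      iχ N (hQ'c t ht)
    have i1 : Integrable (fun y ↦ χN N y * LQ y * Real.exp (-V y)) g.riemVolume := iχ N hLQc
    have i2 : Integrable (fun y ↦ χN N y * Q t y * Real.exp (-V y)) g.riemVolume :=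
      iχ N (hQs t ht).continuous
    have i3 : Integrable (fun y ↦ χN N y * (A t y ^ 2 * Real.exp (-ℓ t y)) * Real.exp (-V y))
        g.riemVolume :=
      iχ N (((hAc t ht).pow 2).mul (Real.continuous_exp.comp (hℓs t ht).continuous.neg))
    have i12 : Integrable (fun y ↦ χN N y * LQ y * Real.exp (-V y)
        - χN N y * Q t y * Real.exp (-V y)) g.riemVolume := i1.sub i2
    have i3' : Integrable (fun y ↦ 2 / n * (χN N y * (A t y ^ 2 * Real.exp (-ℓ t y))
        * Real.exp (-V y))) g.riemVolume := i3.const_mul _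
    have i123 : Integrable (fun y ↦ χN N y * LQ y * Real.exp (-V y)
        - χN N y * Q t y * Real.exp (-V y)
        - 2 / n * (χN N y * (A t y ^ 2 * Real.exp (-ℓ t y)) * Real.exp (-V y))) g.riemVolume :=
      i12.sub i3'
    have hsymm : ∫ y, χN N y * LQ y * Real.exp (-V y) ∂g.riemVolume = EN N t :=
      integral_cutoff_mul_weightedLaplacian_symm hg ((hχs N).of_le (WithTop.coe_le_coe.mpr le_top))
        (hχc N) hQt2 hV1
    calc ∫ y, χN N y * Q' t y * Real.exp (-V y) ∂g.riemVolume
        ≤ ∫ y, (χN N y * LQ y * Real.exp (-V y) - χN N y * Q t y * Real.exp (-V y)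
            - 2 / n * (χN N y * (A t y ^ 2 * Real.exp (-ℓ t y)) * Real.exp (-V y))) ∂g.riemVolume :=
          integral_mono iL i123 hpt
      _ = EN N t - IN N t - 2 / n * DN N t := by
          rw [integral_sub i12 i3', integral_sub i1 i2, integral_const_mul, hsymm]
  -- Cauchy–Schwarz `Y_N² ≤ D_N` (mass of `χ_N u e^{-V}` is at most one)
  have hCS : ∀ N, ∀ t ∈ Ici (0 : ℝ), YN N t ^ 2 ≤ DN N t := by
    intro N t ht
    have hec : Continuous fun y ↦ Real.exp (-ℓ t y) :=
      Real.continuous_exp.comp (hℓs t ht).continuous.neg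
    have hm0 : ∀ y, 0 ≤ χN N y * Real.exp (-ℓ t y) * Real.exp (-V y) := fun y ↦
      mul_nonneg (mul_nonneg (hχ01 N y).1 (Real.exp_pos _).le) (hw0 y)
    have im : Integrable (fun y ↦ χN N y * Real.exp (-ℓ t y) * Real.exp (-V y)) g.riemVolume :=
      iχ N hec
    have iuw : Integrable (fun y ↦ u t y * Real.exp (-V y)) g.riemVolume :=
      integrable_mul_weight (hslice t ht).continuous ⟨b, hub t ht⟩ hw
    have hle : ∀ y, χN N y * Real.exp (-ℓ t y) * Real.exp (-V y) ≤ u t y * Real.exp (-V y) := by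
      intro y
      calc χN N y * Real.exp (-ℓ t y) * Real.exp (-V y)
          = χN N y * (u t y * Real.exp (-V y)) := by rw [hexpℓ t ht y]; ring
        _ ≤ 1 * (u t y * Real.exp (-V y)) :=
          mul_le_mul_of_nonneg_right (hχ01 N y).2 (mul_nonneg (hupos t ht y).le (hw0 y))
        _ = u t y * Real.exp (-V y) := one_mul _
    have hm1 : ∫ y, χN N y * Real.exp (-ℓ t y) * Real.exp (-V y) ∂g.riemVolume ≤ 1 :=
      calc ∫ y, χN N y * Real.exp (-ℓ t y) * Real.exp (-V y) ∂g.riemVolume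
          ≤ ∫ y, u t y * Real.exp (-V y) ∂g.riemVolume := integral_mono im iuw hle
        _ = 1 := hmassu t ht
    have hptA : ∀ y, χN N y * (A t y * Real.exp (-ℓ t y)) * Real.exp (-V y) =
        A t y * (χN N y * Real.exp (-ℓ t y) * Real.exp (-V y)) := fun y ↦ by ring
    have hptA2 : ∀ y, χN N y * (A t y ^ 2 * Real.exp (-ℓ t y)) * Real.exp (-V y) =
        A t y ^ 2 * (χN N y * Real.exp (-ℓ t y) * Real.exp (-V y)) := fun y ↦ by ring
    have iA : Integrable (fun y ↦ A t y * (χN N y * Real.exp (-ℓ t y) * Real.exp (-V y)))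
        g.riemVolume := by
      have h := iχ N (F := fun y ↦ A t y * Real.exp (-ℓ t y)) ((hAc t ht).mul hec)
      exact h.congr (Eventually.of_forall hptA)
    have iA2 : Integrable (fun y ↦ A t y ^ 2 * (χN N y * Real.exp (-ℓ t y) * Real.exp (-V y)))
        g.riemVolume := by
      have h := iχ N (F := fun y ↦ A t y ^ 2 * Real.exp (-ℓ t y)) (((hAc t ht).pow 2).mul hec)
      exact h.congr (Eventually.of_forall hptA2)
    have h := sq_integral_mul_le_of_mass_le_one hm0 hm1 im iA iA2
    have hY : YN N t = ∫ y, A t y * (χN N y * Real.exp (-ℓ t y) * Real.exp (-V y)) ∂g.riemVolume :=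
      integral_congr_ae (Eventually.of_forall hptA)
    have hD : DN N t =
        ∫ y, A t y ^ 2 * (χN N y * Real.exp (-ℓ t y) * Real.exp (-V y)) ∂g.riemVolume :=
      integral_congr_ae (Eventually.of_forall hptA2)
    rw [hY, hD]
    exact h
  /- the three `O(1/N)` error terms -/
  have hIdiff : ∀ N, ∀ t ∈ Ici (0 : ℝ), |If t - IN N t| ≤ CΓ / a * M₁ / ((N : ℝ) + 1) := by
    intro N t ht
    have iQw : Integrable (fun y ↦ Q t y * Real.exp (-V y)) g.riemVolume :=
      integrable_mul_weight (hQs t ht).continuous ⟨CΓ / a, fun y ↦ by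
        rw [abs_of_nonneg (hQbd t ht y).1]; exact (hQbd t ht y).2⟩ hw
    have i2 : Integrable (fun y ↦ χN N y * Q t y * Real.exp (-V y)) g.riemVolume :=
      iχ N (hQs t ht).continuous
    have hpt : ∀ y, Q t y * Real.exp (-V y) - χN N y * Q t y * Real.exp (-V y) =
        (1 - χN N y) * Q t y * Real.exp (-V y) := fun y ↦ by ring
    have hsub : If t - IN N t = ∫ y, (1 - χN N y) * Q t y * Real.exp (-V y) ∂g.riemVolume := by
      rw [hIQ t ht]
      simp only [hINdef]
      rw [← integral_sub iQw i2]
      exact integral_congr_ae (Eventually.of_forall hpt)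
    rw [hsub]
    have hbd : ∀ y, ‖(1 - χN N y) * Q t y * Real.exp (-V y)‖ ≤
        CΓ / a / ((N : ℝ) + 1) * (f y * Real.exp (-V y)) := by
      intro y
      rw [Real.norm_eq_abs, abs_of_nonneg (mul_nonneg (mul_nonneg (h1χ N y).1 (hQbd t ht y).1)
        (hw0 y))]
      have h3 : (1 - χN N y) * Q t y ≤ f y / ((N : ℝ) + 1) * (CΓ / a) :=
        mul_le_mul (h1χ N y).2 (hQbd t ht y).2 (hQbd t ht y).1 (div_nonneg (hf0 y) (hNpos N).le)
      calc (1 - χN N y) * Q t y * Real.exp (-V y)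
          ≤ f y / ((N : ℝ) + 1) * (CΓ / a) * Real.exp (-V y) := mul_le_mul_of_nonneg_right h3 (hw0 y)
        _ = CΓ / a / ((N : ℝ) + 1) * (f y * Real.exp (-V y)) := by ring
    have h := norm_integral_le_of_norm_le (hfw.const_mul _) (Eventually.of_forall hbd)
    rw [integral_const_mul, ← hM₁def] at h
    rw [← Real.norm_eq_abs]
    exact h.trans_eq (by ring)
  have hE : ∀ N, ∀ t ∈ Ici (0 : ℝ), |EN N t| ≤ CΓ / a * Ccut * M₁ / ((N : ℝ) + 1) := by
    intro N t ht
    have hbd : ∀ y, ‖Q t y * Lχ N y * Real.exp (-V y)‖ ≤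
        CΓ / a * Ccut / ((N : ℝ) + 1) * (f y * Real.exp (-V y)) := by
      intro y
      rw [Real.norm_eq_abs, abs_mul, abs_mul, abs_of_nonneg (hQbd t ht y).1, abs_of_nonneg (hw0 y)]
      have h3 : Q t y * |Lχ N y| ≤ CΓ / a * (Ccut * (f y / ((N : ℝ) + 1))) :=
        mul_le_mul (hQbd t ht y).2 (hLχf N y) (abs_nonneg _) (div_nonneg hCΓ0 ha.le)
      calc Q t y * |Lχ N y| * Real.exp (-V y)
          ≤ CΓ / a * (Ccut * (f y / ((N : ℝ) + 1))) * Real.exp (-V y) :=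
            mul_le_mul_of_nonneg_right h3 (hw0 y)
        _ = CΓ / a * Ccut / ((N : ℝ) + 1) * (f y * Real.exp (-V y)) := by ring
    have h := norm_integral_le_of_norm_le (hfw.const_mul _) (Eventually.of_forall hbd)
    rw [integral_const_mul, ← hM₁def] at h
    rw [← Real.norm_eq_abs]
    exact h.trans_eq (by ring)
  have hXY : ∀ N, ∀ t ∈ Ici (0 : ℝ),
      |If t + n / 2 - Ff t - YN N t| ≤ (C₁ * M₁ + M₂ / 2) / ((N : ℝ) + 1) := by
    intro N t ht
    have iAuw : Integrable (fun y ↦ A t y * u t y * Real.exp (-V y)) g.riemVolume := by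
      refine ((hfw.const_mul (1 / 2)).add (hw.const_mul C₁)).mono'
        (((hAc t ht).mul (hslice t ht).continuous).mul hwc).aestronglyMeasurable
        (Eventually.of_forall fun y ↦ ?_)
      rw [Real.norm_eq_abs, abs_mul, abs_of_nonneg (hw0 y)]
      have := hAu t ht y
      show |A t y * u t y| * Real.exp (-V y) ≤ 1 / 2 * (f y * Real.exp (-V y)) + C₁ * Real.exp (-V y)
      nlinarith [hw0 y]
    have iY : Integrable (fun y ↦ χN N y * (A t y * u t y) * Real.exp (-V y)) g.riemVolume :=
      iχ N ((hAc t ht).mul (hslice t ht).continuous)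
    have hptY : ∀ y, χN N y * (A t y * Real.exp (-ℓ t y)) * Real.exp (-V y) =
        χN N y * (A t y * u t y) * Real.exp (-V y) := fun y ↦ by rw [hexpℓ t ht y]
    have hYu : YN N t = ∫ y, χN N y * (A t y * u t y) * Real.exp (-V y) ∂g.riemVolume :=
      integral_congr_ae (Eventually.of_forall hptY)
    have hpt : ∀ y, A t y * u t y * Real.exp (-V y) - χN N y * (A t y * u t y) * Real.exp (-V y) =
        (1 - χN N y) * (A t y * u t y) * Real.exp (-V y) := fun y ↦ by ring
    have hsub : If t + n / 2 - Ff t - YN N t =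
        ∫ y, (1 - χN N y) * (A t y * u t y) * Real.exp (-V y) ∂g.riemVolume := by
      rw [← hX t ht, hYu, ← integral_sub iAuw iY]
      exact integral_congr_ae (Eventually.of_forall hpt)
    rw [hsub]
    have hbd : ∀ y, ‖(1 - χN N y) * (A t y * u t y) * Real.exp (-V y)‖ ≤
        1 / ((N : ℝ) + 1) * (C₁ * (f y * Real.exp (-V y)) + 1 / 2 * (f y ^ 2 * Real.exp (-V y))) := by
      intro y
      rw [Real.norm_eq_abs, abs_mul, abs_mul, abs_of_nonneg (h1χ N y).1, abs_of_nonneg (hw0 y)]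
      have h3 : (1 - χN N y) * |A t y * u t y| ≤ f y / ((N : ℝ) + 1) * (C₁ + f y / 2) :=
        mul_le_mul (h1χ N y).2 (hAu t ht y) (abs_nonneg _) (div_nonneg (hf0 y) (hNpos N).le)
      calc (1 - χN N y) * |A t y * u t y| * Real.exp (-V y)
          ≤ f y / ((N : ℝ) + 1) * (C₁ + f y / 2) * Real.exp (-V y) :=
            mul_le_mul_of_nonneg_right h3 (hw0 y)
        _ = 1 / ((N : ℝ) + 1) * (C₁ * (f y * Real.exp (-V y)) + 1 / 2 * (f y ^ 2 * Real.exp (-V y))) := by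
            ring
    have i1' : Integrable (fun y ↦ C₁ * (f y * Real.exp (-V y))) g.riemVolume := hfw.const_mul C₁
    have i2' : Integrable (fun y ↦ 1 / 2 * (f y ^ 2 * Real.exp (-V y))) g.riemVolume :=
      hf2w.const_mul _
    have i12 : Integrable (fun y ↦ C₁ * (f y * Real.exp (-V y)) + 1 / 2 * (f y ^ 2 * Real.exp (-V y)))
        g.riemVolume := i1'.add i2'
    have ibd : Integrable (fun y ↦ 1 / ((N : ℝ) + 1) *
        (C₁ * (f y * Real.exp (-V y)) + 1 / 2 * (f y ^ 2 * Real.exp (-V y)))) g.riemVolume :=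
      i12.const_mul _
    have h := norm_integral_le_of_norm_le ibd (Eventually.of_forall hbd)
    rw [integral_const_mul, integral_add i1' i2', integral_const_mul, integral_const_mul, ← hM₁def,
      ← hM₂def] at h
    rw [← Real.norm_eq_abs]
    exact h.trans_eq (by ring)
  /- the scale `τ(t) = 1 + (τ₀ − 1)e^{-t}` and the cut-off entropy functionals `Ψ_N` -/
  set τ : ℝ → ℝ := fun t ↦ 1 + (τ₀ - 1) * Real.exp (-t) with hτdef
  have hτd : ∀ t, HasDerivAt τ (1 - τ t) t := fun t ↦ LiWang2020.hasDerivAt_scale τ₀ t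
  have hτpos : ∀ t : ℝ, 0 ≤ t → 0 < τ t := fun t ht ↦
    (lt_min hτ₀ one_pos).trans_le (LiWang2020.min_le_scale ht)
  have hτle : ∀ t : ℝ, 0 ≤ t → τ t ≤ max τ₀ 1 := fun t ht ↦ LiWang2020.scale_le_max ht
  have hστ : ∀ t : ℝ, 0 ≤ t → |1 - τ t| ≤ |τ₀ - 1| := fun t ht ↦ LiWang2020.abs_one_sub_scale_le ht
  have hτc : Continuous τ :=
    continuous_const.add (continuous_const.mul (Real.continuous_exp.comp continuous_neg))
  have hτ0 : τ 0 = τ₀ := by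
    show 1 + (τ₀ - 1) * Real.exp (-0) = τ₀
    rw [neg_zero, Real.exp_zero]; ring
  set Ψ : ℕ → ℝ → ℝ := fun N t ↦
    τ t * IN N t - Hf t + (1 - τ t) * (Ff t - n) - n / 2 * Real.log (τ t) with hΨdef
  set Φ : ℝ → ℝ := fun t ↦ τ t * If t - Hf t + (1 - τ t) * (Ff t - n) - n / 2 * Real.log (τ t)
    with hΦdef
  set γ : ℝ → ℝ := fun t ↦ -Hf t + (1 - τ t) * (Ff t - n) - n / 2 * Real.log (τ t) with hγdef
  set Ψ' : ℕ → ℝ → ℝ := fun N t ↦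
    (1 - τ t) * IN N t + τ t * (∫ y, χN N y * Q' t y * Real.exp (-V y) ∂g.riemVolume)
      + If t - (1 - τ t) * (Ff t - n) + (1 - τ t) * (n / 2 - Ff t) - n / 2 * ((1 - τ t) / τ t)
    with hΨ'def
  set Cε : ℝ := 2 * |τ₀ - 1| * (CΓ / a * M₁ + (C₁ * M₁ + M₂ / 2)) + CΓ / a * M₁
    + max τ₀ 1 * (CΓ / a * Ccut * M₁) with hCεdef
  set ε : ℕ → ℝ := fun N ↦ Cε * (1 / ((N : ℝ) + 1)) with hεdef
  have hΨd : ∀ N, ∀ t : ℝ, 0 < t → HasDerivAt (Ψ N) (Ψ' N t) t := by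
    intro N t ht
    have h1 : HasDerivAt (fun s ↦ τ s * IN N s)
        ((1 - τ t) * IN N t + τ t * ∫ y, χN N y * Q' t y * Real.exp (-V y) ∂g.riemVolume) t :=
      (hτd t).mul (hINd N t ht)
    have h2 := hHd t ht
    have h3 : HasDerivAt (fun s ↦ (1 - τ s) * (Ff s - n))
        ((0 - (1 - τ t)) * (Ff t - n) + (1 - τ t) * (n / 2 - Ff t)) t :=
      ((hasDerivAt_const t (1 : ℝ)).sub (hτd t)).mul ((hFd t ht).sub_const (n : ℝ))
    have h4 : HasDerivAt (fun s ↦ (n : ℝ) / 2 * Real.log (τ s)) ((n : ℝ) / 2 * ((1 - τ t) / τ t)) t :=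
      ((hτd t).log (hτpos t ht.le).ne').const_mul ((n : ℝ) / 2)
    have h := ((h1.sub h2).add h3).sub h4
    refine h.congr_deriv ?_
    simp only [hΨ'def]
    ring
  have hΨ'le : ∀ N, ∀ t : ℝ, 0 < t → Ψ' N t ≤ ε N := by
    intro N t ht
    have ht' : t ∈ Ici (0 : ℝ) := le_of_lt ht
    have hτt := hτpos t ht.le
    have hτne : τ t ≠ 0 := hτt.ne'
    have hd := hdiss N t ht'
    have hsq := LiWang2020.perelman_square_nonpos (Y := YN N t) (D := DN N t) hnr hτt (hCS N t ht')
    have step1 : Ψ' N t ≤ (1 - τ t) * IN N t + τ t * (EN N t - IN N t - 2 / n * DN N t) + If t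
        - (1 - τ t) * (Ff t - n) + (1 - τ t) * (n / 2 - Ff t) - n / 2 * ((1 - τ t) / τ t) := by
      simp only [hΨ'def]
      have := mul_le_mul_of_nonneg_left hd hτt.le
      linarith
    have hid : (1 - τ t) * IN N t + τ t * (EN N t - IN N t - 2 / n * DN N t) + If t
        - (1 - τ t) * (Ff t - n) + (1 - τ t) * (n / 2 - Ff t) - n / 2 * ((1 - τ t) / τ t) =
        (2 * (1 - τ t) * (IN N t - If t + (If t + n / 2 - Ff t - YN N t)) + (If t - IN N t)
          + τ t * EN N t)
        + (-(2 * τ t / n) * DN N t + 2 * (1 - τ t) * YN N t - n / 2 * (1 - τ t) ^ 2 / τ t) := by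
      field_simp
      ring
    rw [hid] at step1
    have e1 := hIdiff N t ht'
    have e2 := hXY N t ht'
    have e3 := hE N t ht'
    have hb1 : 2 * (1 - τ t) * (IN N t - If t + (If t + n / 2 - Ff t - YN N t)) ≤
        2 * |τ₀ - 1| * (CΓ / a * M₁ / ((N : ℝ) + 1) + (C₁ * M₁ + M₂ / 2) / ((N : ℝ) + 1)) := by
      have hx : |IN N t - If t + (If t + n / 2 - Ff t - YN N t)| ≤
          CΓ / a * M₁ / ((N : ℝ) + 1) + (C₁ * M₁ + M₂ / 2) / ((N : ℝ) + 1) :=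
        calc |IN N t - If t + (If t + n / 2 - Ff t - YN N t)|
            ≤ |IN N t - If t| + |If t + n / 2 - Ff t - YN N t| := abs_add_le _ _
          _ ≤ CΓ / a * M₁ / ((N : ℝ) + 1) + (C₁ * M₁ + M₂ / 2) / ((N : ℝ) + 1) :=
              add_le_add (by rw [abs_sub_comm]; exact e1) e2
      calc 2 * (1 - τ t) * (IN N t - If t + (If t + n / 2 - Ff t - YN N t))
          ≤ |2 * (1 - τ t) * (IN N t - If t + (If t + n / 2 - Ff t - YN N t))| := le_abs_self _
        _ = 2 * |1 - τ t| * |IN N t - If t + (If t + n / 2 - Ff t - YN N t)| := by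
            rw [abs_mul, abs_mul, abs_two]
        _ ≤ 2 * |τ₀ - 1| * (CΓ / a * M₁ / ((N : ℝ) + 1) + (C₁ * M₁ + M₂ / 2) / ((N : ℝ) + 1)) :=
            mul_le_mul (by linarith [hστ t ht.le]) hx (abs_nonneg _) (by positivity)
    have hb2 : If t - IN N t ≤ CΓ / a * M₁ / ((N : ℝ) + 1) := (le_abs_self _).trans e1
    have hb3 : τ t * EN N t ≤ max τ₀ 1 * (CΓ / a * Ccut * M₁ / ((N : ℝ) + 1)) := by
      have hτle' := hτle t ht.le
      calc τ t * EN N t ≤ |τ t * EN N t| := le_abs_self _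
        _ = τ t * |EN N t| := by rw [abs_mul, abs_of_pos hτt]
        _ ≤ max τ₀ 1 * (CΓ / a * Ccut * M₁ / ((N : ℝ) + 1)) :=
            mul_le_mul hτle' e3 (abs_nonneg _) (hτt.le.trans hτle')
    have hε : ε N = 2 * |τ₀ - 1| * (CΓ / a * M₁ / ((N : ℝ) + 1) + (C₁ * M₁ + M₂ / 2) / ((N : ℝ) + 1))
        + CΓ / a * M₁ / ((N : ℝ) + 1) + max τ₀ 1 * (CΓ / a * Ccut * M₁ / ((N : ℝ) + 1)) := by
      simp only [hεdef, hCεdef]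
      ring
    linarith [hsq, hb1, hb2, hb3, hε, step1]
  have hΨc : ∀ N, ContinuousOn (Ψ N) (Ici 0) := by
    intro N
    have hτc' : ContinuousOn τ (Ici 0) := hτc.continuousOn
    have hlogc : ContinuousOn (fun t ↦ Real.log (τ t)) (Ici 0) :=
      hτc'.log fun t ht ↦ (hτpos t ht).ne'
    exact (((hτc'.mul (hINc N)).sub hHc).add ((continuousOn_const.sub hτc').mul
      (hFc.sub continuousOn_const))).sub (continuousOn_const.mul hlogc)
  have hstep : ∀ N, ∀ T : ℝ, 0 ≤ T → Ψ N T ≤ Ψ N 0 + ε N * T := fun N T hT ↦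
    LiWang2020.le_add_mul_of_deriv_le (hΨc N) (hΨd N) (hΨ'le N) hT
  /- the limits `N → ∞` and `T → ∞` -/
  have hINlim : ∀ t : ℝ, 0 ≤ t → Tendsto (fun N ↦ IN N t) atTop (𝓝 (If t)) := by
    intro t ht
    have hb : ∀ N, ‖IN N t - If t‖ ≤ CΓ / a * M₁ * (1 / ((N : ℝ) + 1)) := fun N ↦ by
      rw [Real.norm_eq_abs, abs_sub_comm]
      calc |If t - IN N t| ≤ CΓ / a * M₁ / ((N : ℝ) + 1) := hIdiff N t ht
        _ = CΓ / a * M₁ * (1 / ((N : ℝ) + 1)) := by ring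
    have h0 : Tendsto (fun N : ℕ ↦ CΓ / a * M₁ * (1 / ((N : ℝ) + 1))) atTop (𝓝 0) := by
      simpa using tendsto_one_div_add_atTop_nhds_zero_nat.const_mul (CΓ / a * M₁)
    exact tendsto_sub_nhds_zero_iff.1 (squeeze_zero_norm hb h0)
  have hlimN : ∀ t : ℝ, 0 ≤ t → Tendsto (fun N ↦ Ψ N t) atTop (𝓝 (Φ t)) := by
    intro t ht
    have h := ((((tendsto_const_nhds (x := τ t)).mul (hINlim t ht)).sub
      (tendsto_const_nhds (x := Hf t))).add
      (tendsto_const_nhds (x := (1 - τ t) * (Ff t - n)))).sub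
      (tendsto_const_nhds (x := (n : ℝ) / 2 * Real.log (τ t)))
    exact h
  have hεlim : Tendsto ε atTop (𝓝 0) := by
    have h := tendsto_one_div_add_atTop_nhds_zero_nat.const_mul Cε
    rw [mul_zero] at h
    exact h
  have hlow : ∀ T : ℝ, 0 ≤ T → γ T ≤ Φ T := by
    intro T hT
    have : 0 ≤ τ T * If T := mul_nonneg (hτpos T hT).le (hIf0 T hT)
    simp only [hγdef, hΦdef]
    linarith
  have hγlim : Tendsto γ atTop (𝓝 0) := by
    have h1 : Tendsto (fun T ↦ (1 - τ T) * (Ff T - n)) atTop (𝓝 0) := by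
      have hb : ∀ᶠ T in atTop, ‖(1 - τ T) * (Ff T - n)‖ ≤ |τ₀ - 1| * (b * M₁ + n) * Real.exp (-T) := by
        filter_upwards [eventually_ge_atTop (0 : ℝ)] with T hT
        rw [Real.norm_eq_abs, abs_mul]
        have hσ : |1 - τ T| = |τ₀ - 1| * Real.exp (-T) := by
          show |1 - (1 + (τ₀ - 1) * Real.exp (-T))| = |τ₀ - 1| * Real.exp (-T)
          rw [show 1 - (1 + (τ₀ - 1) * Real.exp (-T)) = -((τ₀ - 1) * Real.exp (-T)) by ring,
            abs_neg, abs_mul, abs_of_pos (Real.exp_pos _)]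
        have hF : |Ff T - n| ≤ b * M₁ + n := by
          calc |Ff T - n| ≤ |Ff T| + |(n : ℝ)| := abs_sub _ _
            _ ≤ b * M₁ + n := by rw [Nat.abs_cast]; linarith [hFbd T hT]
        rw [hσ]
        have he : 0 ≤ |τ₀ - 1| * Real.exp (-T) := by positivity
        calc |τ₀ - 1| * Real.exp (-T) * |Ff T - n| ≤ |τ₀ - 1| * Real.exp (-T) * (b * M₁ + n) :=
              mul_le_mul_of_nonneg_left hF he
          _ = |τ₀ - 1| * (b * M₁ + n) * Real.exp (-T) := by ring
      have h0 : Tendsto (fun T ↦ |τ₀ - 1| * (b * M₁ + n) * Real.exp (-T)) atTop (𝓝 0) := by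
        have h := Real.tendsto_exp_neg_atTop_nhds_zero.const_mul (|τ₀ - 1| * (b * M₁ + n))
        rw [mul_zero] at h
        exact h
      exact squeeze_zero_norm' hb h0
    have h2 : Tendsto (fun T ↦ Real.log (τ T)) atTop (𝓝 0) := by
      have h := (Real.continuousAt_log one_ne_zero).tendsto.comp (LiWang2020.tendsto_scale τ₀)
      rw [Real.log_one] at h
      exact h
    have h := (hHlim.neg.add h1).sub (h2.const_mul ((n : ℝ) / 2))
    rw [neg_zero, zero_add, mul_zero, sub_zero] at h
    exact h
  have hmain := LiWang2020.nonneg_of_monotonicity hstep hlimN hεlim hlow hγlim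
  /- identification of `Φ(0)` -/
  have hH0 : Hf 0 = ∫ x, φ x * (Real.exp (φ x) * Real.exp (-V x)) ∂g.riemVolume := by
    simp only [hHfdef, hu0]
    refine integral_congr_ae (Eventually.of_forall fun x ↦ ?_)
    simp only [hρdef, Real.log_exp]
    ring
  have hI0 : If 0 = ∫ x, g.gradSq φ x * (Real.exp (φ x) * Real.exp (-V x)) ∂g.riemVolume := by
    simp only [hIfdef, hu0]
    refine integral_congr_ae (Eventually.of_forall fun x ↦ ?_)
    dsimp only
    rw [hΓρ x]
    simp only [hρdef]
    have hne : Real.exp (φ x) ≠ 0 := (Real.exp_pos _).ne'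
    field_simp
  have hF0 : Ff 0 = ∫ x, f x * (Real.exp (φ x) * Real.exp (-V x)) ∂g.riemVolume := by
    simp only [hFfdef, hu0]
    refine integral_congr_ae (Eventually.of_forall fun x ↦ ?_)
    simp only [hρdef]
    ring
  have hΦ0 : Φ 0 = τ₀ * If 0 - Hf 0 + (1 - τ₀) * (Ff 0 - n) - n / 2 * Real.log τ₀ := by
    simp only [hΦdef, hτ0]
  rw [hΦ0, hI0, hH0, hF0] at hmain
  linarith

/-- **Li–Wang's logarithmic Sobolev inequality at every scale, for densities constant outside a
compact set, from the weighted heat semigroup of the shrinker** (Li–Wang 2020, Thm. 1.1 via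
Thm. 4.3/Thm. 4.5, Prop. 5.7/5.9 and Lemma 5.10, in the static frame). On a complete connected
gradient shrinker `Ric + Hess f = g/2`, `R + |∇f|² = f` (`R ≥ 0`, `f` proper, `n ≥ 1`) with
weight `e^{-V}`, `V = f + c`, `∫ e^{-V} = 1`, GIVEN operators `P t` with the properties (i)–(iv) of
`weightedHeatSemigroup_strongGradientBound_complete` for `K = 1/2`: for `τ₀ > 0` and `φ` smooth,
constant outside a compact set, with `∫ e^φ e^{-V} = 1`,
`∫ φ e^φ e^{-V} ≤ τ₀ ∫ |∇φ|² e^φ e^{-V} + (1 − τ₀)(∫ f e^φ e^{-V} − n) − (n/2) log τ₀`.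
Proof: the flow `u(t) = P_t e^φ` has the a-priori properties required by
`shrinker_asei_eventuallyConst_of_flow` — values in `[e^{-C}, e^{C}]` (`|φ| ≤ C`, Markov property),
`|Lu(t)| = |P_t(L e^φ)| ≤ sup |L e^φ|`, `|∇u(t)|² ≤ e^{-t} sup |∇e^φ|²` (strong gradient bound and
`P_t h ≤ sup h`), unit mass (invariance of `e^{-V}`).
[cite: LiWang2020, Thm. 1.1, Thm. 4.3, Prop. 5.9 and Lemma 5.10 (arXiv:1901.05691, pp. 3, 14, 20)] -/
theorem shrinker_asei_eventuallyConst_of_semigroup (hg : g.IsRiemannian)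
    (hc : ∀ (x : M) (r : NNReal), IsCompact {y : M | g.edist hg x y ≤ r}) (hn : 0 < n)
    {f : M → ℝ} (hf : ContMDiff (𝓡 n) 𝓘(ℝ, ℝ) ∞ f)
    (hsol : ∀ (x : M) (X Y : TangentSpace (𝓡 n) x),
      g.ricci x X Y + g.hessian f x X Y = (1 / 2 : ℝ) * g.val x X Y)
    (hnorm : ∀ x : M, g.scalarCurvature x + g.gradSq f x = f x)
    (hS : ∀ x, 0 ≤ g.scalarCurvature x) (hprop : ∀ c : ℝ, IsCompact {x | f x ≤ c})
    {V : M → ℝ} {cV : ℝ} (hVf : ∀ x, V x = f x + cV)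
    (hmass : ∫ x, Real.exp (-V x) ∂g.riemVolume = 1)
    (hfw : Integrable (fun x ↦ f x * Real.exp (-V x)) g.riemVolume)
    (P : ℝ → (M → ℝ) → M → ℝ)
    (hPlin : ∀ t : ℝ, 0 ≤ t → ∀ (h₁ h₂ : M → ℝ) (c : ℝ), Continuous h₁ → (∃ C, ∀ x, |h₁ x| ≤ C) →
      Continuous h₂ → (∃ C, ∀ x, |h₂ x| ≤ C) →
      P t (fun x ↦ c * h₁ x + h₂ x) = fun x ↦ c * P t h₁ x + P t h₂ x)
    (hPpos : ∀ t : ℝ, 0 ≤ t → ∀ h : M → ℝ, Continuous h → (∃ C, ∀ x, |h x| ≤ C) →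
      (∀ x, 0 ≤ h x) → ∀ x, 0 ≤ P t h x)
    (hPone : ∀ t : ℝ, 0 ≤ t → P t (fun _ ↦ (1 : ℝ)) = fun _ ↦ 1)
    (hPinv : ∀ t : ℝ, 0 ≤ t → ∀ h : M → ℝ, Continuous h → (∃ C, ∀ x, |h x| ≤ C) →
      ∫ x, P t h x * Real.exp (-V x) ∂g.riemVolume = ∫ x, h x * Real.exp (-V x) ∂g.riemVolume)
    (hPflow : ∀ h₀ : M → ℝ, ContMDiff (𝓡 n) 𝓘(ℝ, ℝ) ∞ h₀ →
      (∃ K₀ : Set M, IsCompact K₀ ∧ ∃ c : ℝ, ∀ x, x ∉ K₀ → h₀ x = c) →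
      ContMDiffOn ((𝓡 n).prod 𝓘(ℝ, ℝ)) 𝓘(ℝ, ℝ) ∞ (fun p : M × ℝ ↦ P p.2 h₀ p.1) (univ ×ˢ Ici 0) ∧
      P 0 h₀ = h₀ ∧
      (∀ t ∈ Ici (0 : ℝ), ∀ x, derivWithin (fun s ↦ P s h₀ x) (Ici 0) t =
        g.dalembertian (P t h₀) x
          - g.innerDual x (mvfderiv (𝓡 n) V x : TangentSpace (𝓡 n) x →ₗ[ℝ] ℝ)
              (mvfderiv (𝓡 n) (P t h₀) x : TangentSpace (𝓡 n) x →ₗ[ℝ] ℝ)) ∧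
      (∀ t ∈ Ici (0 : ℝ), ∀ x, derivWithin (fun s ↦ P s h₀ x) (Ici 0) t =
        P t (fun y ↦ g.dalembertian h₀ y
          - g.innerDual y (mvfderiv (𝓡 n) V y : TangentSpace (𝓡 n) y →ₗ[ℝ] ℝ)
              (mvfderiv (𝓡 n) h₀ y : TangentSpace (𝓡 n) y →ₗ[ℝ] ℝ)) x) ∧
      (∀ t ∈ Ici (0 : ℝ), ∀ x, Real.sqrt (g.gradSq (P t h₀) x) ≤
        Real.exp (-(1 / 2 : ℝ) * t) * P t (fun y ↦ Real.sqrt (g.gradSq h₀ y)) x))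
    {τ₀ : ℝ} (hτ₀ : 0 < τ₀) (φ : M → ℝ) (hφ : ContMDiff (𝓡 n) 𝓘(ℝ, ℝ) ∞ φ)
    (hφK : ∃ K₀ : Set M, IsCompact K₀ ∧ ∃ c : ℝ, ∀ x, x ∉ K₀ → φ x = c)
    (hφmass : ∫ x, Real.exp (φ x) * Real.exp (-V x) ∂g.riemVolume = 1) :
    ∫ x, φ x * (Real.exp (φ x) * Real.exp (-V x)) ∂g.riemVolume ≤
      τ₀ * ∫ x, g.gradSq φ x * (Real.exp (φ x) * Real.exp (-V x)) ∂g.riemVolume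
        + (1 - τ₀) * (∫ x, f x * (Real.exp (φ x) * Real.exp (-V x)) ∂g.riemVolume - n)
        - n / 2 * Real.log τ₀ := by
  haveI : Nonempty M := ConnectedSpace.toNonempty
  obtain ⟨o⟩ := ‹Nonempty M›
  obtain ⟨K₀, hK₀, cφ, hcφ⟩ := hφK
  have hVeq : V = fun x ↦ f x + cV := funext hVf
  have hV : ContMDiff (𝓡 n) 𝓘(ℝ, ℝ) ∞ V := by rw [hVeq]; exact hf.add contMDiff_const
  have hV1 : ContMDiff (𝓡 n) 𝓘(ℝ, ℝ) 1 V := hV.of_le (by norm_num)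
  /- the datum `ρ = e^φ` and its bounds -/
  set ρ : M → ℝ := fun x ↦ Real.exp (φ x) with hρdef
  have hρ : ContMDiff (𝓡 n) 𝓘(ℝ, ℝ) ∞ ρ := Real.contDiff_exp.comp_contMDiff hφ
  have hρ1 : ContMDiff (𝓡 n) 𝓘(ℝ, ℝ) 1 ρ := hρ.of_le (by norm_num)
  have hρ2 : ContMDiff (𝓡 n) 𝓘(ℝ, ℝ) 2 ρ := hρ.of_le (WithTop.coe_le_coe.mpr le_top)
  have hρK : ∃ K₀ : Set M, IsCompact K₀ ∧ ∃ c : ℝ, ∀ x, x ∉ K₀ → ρ x = c :=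
    ⟨K₀, hK₀, Real.exp cφ, fun x hx ↦ by simp only [hρdef, hcφ x hx]⟩
  obtain ⟨Cφ, hCφ⟩ := exists_forall_abs_le_of_eventuallyConst hφ.continuous ⟨K₀, hK₀, cφ, hcφ⟩
  set a : ℝ := Real.exp (-Cφ) with hadef
  set b : ℝ := Real.exp Cφ with hbdef
  have ha : 0 < a := Real.exp_pos _
  have hρa : ∀ x, a ≤ ρ x := fun x ↦ Real.exp_le_exp.2 (neg_le_of_abs_le (hCφ x))
  have hρb : ∀ x, ρ x ≤ b := fun x ↦ Real.exp_le_exp.2 (le_of_abs_le (hCφ x))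
  have hρpos : ∀ x, 0 < ρ x := fun x ↦ Real.exp_pos _
  have hρbd : ∃ C, ∀ x, |ρ x| ≤ C := ⟨b, fun x ↦ by rw [abs_of_pos (hρpos x)]; exact hρb x⟩
  have hΓφc : Continuous (g.gradSq φ) := (contMDiff_gradSq g hφ).continuous
  obtain ⟨CΓφ, hCΓφ⟩ := exists_forall_abs_le_of_eventuallyConst hΓφc ⟨K₀, hK₀, 0, fun x hx ↦
    g.gradSq_eq_zero_of_mvfderiv_eq_zero (mvfderiv_eq_zero_of_eventuallyConst hK₀ hcφ hx)⟩
  have hΓρ : ∀ x, g.gradSq ρ x = ρ x ^ 2 * g.gradSq φ x := fun x ↦ by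
    have hh : HasDerivAt Real.exp (Real.exp (φ x)) (φ x) := Real.hasDerivAt_exp _
    exact g.gradSq_real_comp hh (hφ.mdifferentiableAt (by simp))
  set CΓ : ℝ := b ^ 2 * CΓφ with hCΓdef
  have hΓρb : ∀ x, g.gradSq ρ x ≤ CΓ := fun x ↦ by
    rw [hΓρ x]
    exact mul_le_mul (pow_le_pow_left₀ (hρpos x).le (hρb x) 2) ((le_abs_self _).trans (hCΓφ x))
      (g.gradSq_nonneg hg φ x) (sq_nonneg _)
  have hCΓ0 : 0 ≤ CΓ := (g.gradSq_nonneg hg ρ o).trans (hΓρb o)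
  set Lρ : M → ℝ := fun y ↦ g.dalembertian ρ y
      - g.innerDual y (mvfderiv (𝓡 n) V y : TangentSpace (𝓡 n) y →ₗ[ℝ] ℝ)
          (mvfderiv (𝓡 n) ρ y : TangentSpace (𝓡 n) y →ₗ[ℝ] ℝ) with hLρdef
  have hLρc : Continuous Lρ :=
    (continuous_dalembertian g hρ2).sub (continuous_innerDual_mvfderiv g hV1 hρ1)
  obtain ⟨CL, hCL⟩ := exists_forall_abs_le_of_eventuallyConst hLρc ⟨K₀, hK₀, 0, fun x hx ↦
    weightedLaplacian_eq_zero_of_eventuallyConst hρ hK₀ (c := Real.exp cφ)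
      (fun y hy ↦ by simp only [hρdef, hcφ y hy]) hx⟩
  /- the flow `u(t) = P_t ρ` and its a-priori bounds -/
  obtain ⟨hu, hu0, hueq, hueq', hugrad⟩ := hPflow ρ hρ hρK
  set u : ℝ → M → ℝ := fun t ↦ P t ρ with hudef
  have hab : ∀ t ∈ Ici (0 : ℝ), ∀ x, a ≤ u t x ∧ u t x ≤ b := fun t ht x ↦
    markov_apply_mem_Icc (hPlin t ht) (hPpos t ht) (hPone t ht) hρ.continuous hρa hρb x
  have hLu : ∀ t ∈ Ici (0 : ℝ), ∀ x, |g.dalembertian (u t) x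
      - g.innerDual x (mvfderiv (𝓡 n) V x : TangentSpace (𝓡 n) x →ₗ[ℝ] ℝ)
          (mvfderiv (𝓡 n) (u t) x : TangentSpace (𝓡 n) x →ₗ[ℝ] ℝ)| ≤ CL := by
    intro t ht x
    have h1 := hueq t ht x
    have h2 := hueq' t ht x
    simp only [hudef]
    rw [← h1, h2]
    have h3 := markov_apply_mem_Icc (hPlin t ht) (hPpos t ht) (hPone t ht) hLρc
      (fun y ↦ neg_le_of_abs_le (hCL y)) (fun y ↦ le_of_abs_le (hCL y)) x
    exact abs_le.2 h3
  have hGdecay : ∀ t ∈ Ici (0 : ℝ), ∀ x, g.gradSq (u t) x ≤ Real.exp (-t) * CΓ := by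
    intro t ht x
    have h1 := hugrad t ht x
    have h2 : P t (fun y ↦ Real.sqrt (g.gradSq ρ y)) x ≤ Real.sqrt CΓ :=
      (markov_apply_mem_Icc (hPlin t ht) (hPpos t ht) (hPone t ht)
        (contMDiff_gradSq g hρ).continuous.sqrt (fun y ↦ Real.sqrt_nonneg _)
        (fun y ↦ Real.sqrt_le_sqrt (hΓρb y)) x).2
    have h3 : Real.sqrt (g.gradSq (u t) x) ≤ Real.exp (-(1 / 2 : ℝ) * t) * Real.sqrt CΓ :=
      h1.trans (mul_le_mul_of_nonneg_left h2 (Real.exp_pos _).le)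
    have h4 := pow_le_pow_left₀ (Real.sqrt_nonneg _) h3 2
    rw [Real.sq_sqrt (g.gradSq_nonneg hg _ x), mul_pow, Real.sq_sqrt hCΓ0] at h4
    have h5 : (Real.exp (-(1 / 2 : ℝ) * t)) ^ 2 = Real.exp (-t) := by
      rw [sq, ← Real.exp_add]; congr 1; ring
    rwa [h5] at h4
  have hmassu : ∀ t ∈ Ici (0 : ℝ), ∫ x, u t x * Real.exp (-V x) ∂g.riemVolume = 1 := by
    intro t ht
    simp only [hudef]
    rw [hPinv t ht ρ hρ.continuous hρbd]
    exact hφmass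
  exact shrinker_asei_eventuallyConst_of_flow hg hc hn hf hsol hnorm hS hprop hVf hmass hfw u hu
    hueq ha hab hLu hGdecay hmassu hτ₀ φ hφ hu0

end Flow

end Literature.Geometry.Riemannian

end
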